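import Literature.Analysis.FluidPDE.NSVorticityEnergy
import HarnessLib

/-!
# The vorticity energy method for classical Navier–Stokes solutions, II: the slice inequality

Analysis/FluidPDE support file, the fourth of five files discharging
`Literature.Analysis.FluidPDE.tao2011_hasBoundedSobolevNormsOn_of_memSobolevX` (Tao 2011, Cor. 4.3 + Thm. 5.4 (iv),
homogeneous case, classical solutions) by the energy method for the vorticity equation
(`CoordDerivatives` → `EnergyToolkit` → `NSVorticityEnergy` → `NSVorticitySlice` →
`NSEnstrophyPersistence`). This file proves the **fixed-time differential inequality**, stated
abstractly for a smooth divergence-free field `v` on `ℝ³` (later `v = u(t)`), a smooth cutoff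
`0 ≤ φ ≤ 1` with `‖Dφ‖ ≤ c` and compact support (later `φ = χ_R`), a companion cutoff `φ'`
equal to `1` on the support of `φ` (later `χ_{2R}`), and a continuous family `Ẇ = (Ẇ_{βki})`
(later the time derivatives `∂ₜ∂^βΩ_{ki}`) subject only to the pointwise forcing bound of
`NSVorticityEnergy.abs_vorticity_forcing_le`:

`slice_energy_inequality_core`: given `ν > 0`, `c`, `C_F`, `n ≥ 1` and global level bounds
`S m ≥ ∫ |∇ᵐv|²` (`m ≤ n`), there is a constant `C₀` (depending only on these data and on the
Gagliardo–Nirenberg–Sobolev constant of `ℝ³`) such that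
`∑_{β,k,i} 2 ∫ φ⁴ Ẇ_{βki} ∂^βΩ_{ki} ≤ −ν ∫ φ⁴ |∇^{n+1}Ω|² + C₀ (1 + ∫ φ⁴ |∇ⁿΩ|² + ∫ φ² |∇^{n+1}v|²)`,
where `|∇ᵐΩ|² = vortSq m v` and `|∇ᵐv|² = levelSq m v` are the coordinate tensors of
`CoordDerivatives`. Writing `F = Ẇ − νΔW + v·∇W` for each component `W = ∂^βΩ_{ki}`
(`component_pairing_le`), the three contributions are:

* the **viscous pairing** `2∫ φ⁴ W ΔW ≤ −(3/2) ∫ φ⁴|∇W|² + 96 c² ∫ φ²W²` (integration by parts;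
  the cutoff error `8 φ³ ∂ⱼφ W ∂ⱼW` is split by the pointwise Young inequality
  `viscous_pointwise`);
* the **transport pairing** `−2∫ φ⁴ W (v·∇)W = ∫ 4φ³ (∇φ·v) W²` (integration by parts,
  `div v = 0`), bounded in `transport_term_le` by the trilinear Hölder–Sobolev estimate of
  `EnergyToolkit` applied to `f = φ |∇ⁿΩ|`, `Φ₁ = φ² (∂^βΩ_{ki})_{βki}`, `Φ₂ = φ' v` and the
  three-term weighted AM–GM inequality, then absorbed into `(ν/4) ∫ φ⁴|∇^{n+1}Ω|²`
  (`exists_eps_absorb_three`);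
* the **forcing (vortex-stretching and commutator) terms** `2∫ φ⁴ W F` with
  `|F| ≤ C_F ∑_{a=1}^{n+1} |∇ᵃv| |∇^{n+2−a}v|` (`forcing_term_le`): after the symmetrisation
  `a ↔ n + 2 − a` each piece `∫ |∇ᵃv| · φ²|∇ᵇv| · φ²|∇ⁿΩ|` (`a ≤ n`, `b = n + 2 − a ≥ 2`) is a
  trilinear Hölder `(2, 3, 6)`–Sobolev term (`forcing_trilinear_piece`) in which the global
  factor `‖∇ᵃv‖₂ ≤ S_a^{1/2}` is a hypothesis, the top-order factor `∫ φ⁴|∇^{n+2}v|²` arising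
  for `a = n` inside `‖D(φ²∇^{n+1}v)‖₂²` is returned to `∫ φ⁴|∇^{n+1}Ω|²` by the weighted
  div–curl inequality of `NSVorticityEnergy`, and everything is absorbed by the four-term
  weighted AM–GM inequality with a small parameter (`exists_eps_absorb_four`).

Supporting sections: operator-norm bounds for derivatives of the weighted bundled families
`φ² • (∂^γvᵢ)_{(γ,i)}`, `φ² • (∂^βΩ_{ki})_{(β,k,i)}` (`Weighted`; needed because Mathlib's
Sobolev inequality is stated with `‖DΦ‖`), and the elementary absorption lemmas (`Absorb`).
Dimension `3` enters only through the Sobolev exponent `6` (and `card (Fin 3) = 3` in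
constants). No new definitions; all statements are tagged folklore — the scheme is the
classical `H^m` energy estimate (Majda–Bertozzi 2002, §3.2, Prop. 3.7) run on the vorticity
equation and localised with cutoffs because no spatial decay of the higher derivatives of a
classical solution is assumed.

## References

* A. J. Majda, A. L. Bertozzi, *Vorticity and Incompressible Flow*, CUP (2002)
  (`MajdaBertozzi2002`), §3.2, Prop. 3.7 "The `H^m` energy estimate", eq. (3.58) and its proof
  (held copy p. 93). [folklore]
* C. R. Doering, J. D. Gibbon, *Applied Analysis of the Navier–Stokes Equations*, CUP (1995)
  (`DoeringGibbon1995`), §6.1, (6.1.2) and (6.1.5)–(6.1.9) (held copy pp. 96–97: the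
  seminorms `H_N = ∑ᵢ ∫ |Dᴺuᵢ|²`, sum of squares of all order-`N` partials, and
  `∫|∇u|² = ∫|curl u|²`) and §6.2, Thm. 6.1 (the "ladder theorem" for the `H_N`, periodic
  case; held copy p. 99). [folklore]
* T. Tao, arXiv:1108.1165 (`Tao2011`), Cor. 4.3, Thm. 5.4 (iv) (the fact being discharged).
-/

noncomputable section

open MeasureTheory Set Function Filter Topology
open scoped ENNReal NNReal ContDiff BigOperators

namespace Literature.Analysis.FluidPDE

/-! ## Scalar building blocks: the viscous and transport pairings against a weight `φ⁴` -/

section Scalar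

variable {ι : Type*} [Fintype ι] [DecidableEq ι]


omit [Fintype ι] [DecidableEq ι] in
/-- Pointwise Young inequality behind the viscous cutoff error: with `0 ≤ φ`, `|dφ| ≤ c`,
`-2 (4φ³ dφ W + φ⁴ dW) dW ≤ -(3/2) φ⁴ dW² + 32 c² φ² W²`. [folklore] -/
theorem viscous_pointwise {φ dφ W dW c : ℝ} (hφ : 0 ≤ φ) (hc : |dφ| ≤ c) :
    -2 * (φ ^ 3 * ((4 * dφ * W + φ * dW) * dW)) ≤
      -(3 / 2) * (φ ^ 4 * dW ^ 2) + 32 * c ^ 2 * (φ ^ 2 * W ^ 2) := by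
  have hc0 : 0 ≤ c := (abs_nonneg _).trans hc
  have e : |8 * (φ ^ 3 * dφ * W * dW)| = 8 * (φ ^ 3 * (|dφ| * (|W| * |dW|))) := by
    rw [abs_mul, abs_of_nonneg (by norm_num : (0:ℝ) ≤ 8), abs_mul, abs_mul, abs_mul,
      abs_of_nonneg (pow_nonneg hφ 3)]
    ring
  have h1 : |8 * (φ ^ 3 * dφ * W * dW)| ≤ 8 * c * (φ ^ 2 * |dW|) * (φ * |W|) := by
    rw [e]
    have : 8 * (φ ^ 3 * (|dφ| * (|W| * |dW|))) ≤ 8 * (φ ^ 3 * (c * (|W| * |dW|))) :=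
      mul_le_mul_of_nonneg_left (mul_le_mul_of_nonneg_left
        (mul_le_mul_of_nonneg_right hc (by positivity)) (pow_nonneg hφ 3)) (by norm_num)
    exact this.trans (le_of_eq (by ring))
  have h2 : 8 * c * (φ ^ 2 * |dW|) * (φ * |W|) ≤
      2⁻¹ * (φ ^ 2 * |dW|) ^ 2 + 32 * c ^ 2 * (φ * |W|) ^ 2 := by
    nlinarith [sq_nonneg (φ ^ 2 * |dW| - 8 * c * (φ * |W|))]
  have e2 : (φ ^ 2 * |dW|) ^ 2 = φ ^ 4 * dW ^ 2 := by rw [mul_pow, sq_abs]; ring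
  have e3 : (φ * |W|) ^ 2 = φ ^ 2 * W ^ 2 := by rw [mul_pow, sq_abs]
  have key : -(8 * (φ ^ 3 * dφ * W * dW)) ≤ 2⁻¹ * (φ ^ 4 * dW ^ 2) + 32 * c ^ 2 * (φ ^ 2 * W ^ 2) := by
    rw [← e2, ← e3]
    exact (neg_le_abs _).trans (h1.trans h2)
  have expand : -2 * (φ ^ 3 * ((4 * dφ * W + φ * dW) * dW)) =
      -(8 * (φ ^ 3 * dφ * W * dW)) - 2 * (φ ^ 4 * dW ^ 2) := by ring
  rw [expand]
  linarith

/-- **The viscous pairing in one direction.** For smooth `W`, a smooth compactly supported weight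
`0 ≤ φ` with `|∂φ| ≤ c`, and a direction `j`:
`2 ∫ φ⁴ W ∂ⱼ∂ⱼW ≤ -(3/2) ∫ φ⁴ (∂ⱼW)² + 32 c² ∫ φ² W²` (integration by parts of `∂ⱼ` against
`φ⁴ W` and the pointwise Young inequality for the cutoff error `4φ³∂ⱼφ W ∂ⱼW`). [folklore] -/
theorem viscous_pairing_dir_le {W φ : EuclideanSpace ℝ ι → ℝ} (hW : ContDiff ℝ ∞ W) (hφ : ContDiff ℝ ∞ φ)
    (hφc : HasCompactSupport φ) (hφ0 : ∀ x, 0 ≤ φ x) {c : ℝ} (hc : ∀ l x, |pderiv l φ x| ≤ c)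
    (j : ι) :
    2 * ∫ x, φ x ^ 4 * (W x * pderiv j (pderiv j W) x) ≤
      -(3 / 2) * (∫ x, φ x ^ 4 * pderiv j W x ^ 2) + 32 * c ^ 2 * ∫ x, φ x ^ 2 * W x ^ 2 := by
  have hφcont : Continuous φ := hφ.continuous
  have hφd : Differentiable ℝ φ := hφ.differentiable (by simp)
  have hWd : Differentiable ℝ W := hW.differentiable (by simp)
  have hdW : ContDiff ℝ ∞ (pderiv j W) := contDiff_pderiv hW j
  have hφ4d : Differentiable ℝ (fun y => φ y ^ 4) := hφd.pow 4
  have cW : Continuous W := hW.continuous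
  have cdW : Continuous (pderiv j W) := hdW.continuous
  have cdφ : Continuous (pderiv j φ) := continuous_pderiv hφ (by simp) j
  -- integration by parts
  have hIBP : ∫ x, φ x ^ 4 * (W x * pderiv j (pderiv j W) x) =
      -∫ x, φ x ^ 3 * ((4 * pderiv j φ x * W x + φ x * pderiv j W x) * pderiv j W x) := by
    have h1 : ∫ x, φ x ^ 4 * (W x * pderiv j (pderiv j W) x) =
        ∫ x, (fun y => φ y ^ 4 * W y) x * pderiv j (pderiv j W) x :=
      integral_congr_ae (Eventually.of_forall fun x => by simp only; ring)
    rw [h1, integral_mul_pderiv_eq_neg (ψ := fun y => φ y ^ 4 * W y)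
      (((hφ.pow 4).mul hW).of_le (by exact_mod_cast le_top))
      ((hasCompactSupport_pow hφc (by norm_num : (4:ℕ) ≠ 0)).mul_right)
      (hdW.of_le (by exact_mod_cast le_top)) j]
    congr 1
    refine integral_congr_ae (Eventually.of_forall fun x => ?_)
    have e := congrFun (pderiv_mul (f := fun y => φ y ^ 4) (g := W) hφ4d hWd j) x
    simp only at e ⊢
    rw [e, pderiv_pow_four hφd]
    ring
  -- the pointwise bound, integrated
  have i₁ : Integrable fun x => φ x ^ 3 * ((4 * pderiv j φ x * W x + φ x * pderiv j W x) *
      pderiv j W x) :=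
    integrable_pow_mul_of_continuous hφcont hφc
      ((((continuous_const.mul cdφ).mul cW).add (hφcont.mul cdW)).mul cdW) (by norm_num)
  have i₂ : Integrable fun x => φ x ^ 4 * pderiv j W x ^ 2 :=
    integrable_pow_mul_of_continuous hφcont hφc (cdW.pow 2) (by norm_num)
  have i₃ : Integrable fun x => φ x ^ 2 * W x ^ 2 :=
    integrable_pow_mul_of_continuous hφcont hφc (cW.pow 2) (by norm_num)
  have hmono : ∫ x, -2 * (φ x ^ 3 * ((4 * pderiv j φ x * W x + φ x * pderiv j W x) *
      pderiv j W x)) ≤ ∫ x, (-(3 / 2) * (φ x ^ 4 * pderiv j W x ^ 2) +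
        32 * c ^ 2 * (φ x ^ 2 * W x ^ 2)) :=
    integral_mono (i₁.const_mul _) ((i₂.const_mul _).add (i₃.const_mul _)) fun x =>
      viscous_pointwise (hφ0 x) (hc j x)
  rw [integral_const_mul, integral_add (i₂.const_mul _) (i₃.const_mul _), integral_const_mul,
    integral_const_mul] at hmono
  rw [hIBP]
  linarith

/-- **The viscous pairing**: `2 ∫ φ⁴ W ΔW ≤ -(3/2) ∫ φ⁴ |∇W|² + 32 c² (card ι) ∫ φ² W²` with
`ΔW = ∑ⱼ ∂ⱼ∂ⱼW`, `|∇W|² = ∑ⱼ (∂ⱼW)²`. [folklore] -/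
theorem viscous_pairing_le {W φ : EuclideanSpace ℝ ι → ℝ} (hW : ContDiff ℝ ∞ W) (hφ : ContDiff ℝ ∞ φ)
    (hφc : HasCompactSupport φ) (hφ0 : ∀ x, 0 ≤ φ x) {c : ℝ} (hc : ∀ l x, |pderiv l φ x| ≤ c) :
    2 * ∫ x, φ x ^ 4 * (W x * ∑ j, pderiv j (pderiv j W) x) ≤
      -(3 / 2) * (∫ x, φ x ^ 4 * ∑ j, pderiv j W x ^ 2) +
        32 * c ^ 2 * Fintype.card ι * ∫ x, φ x ^ 2 * W x ^ 2 := by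
  have hφcont : Continuous φ := hφ.continuous
  have cW : Continuous W := hW.continuous
  have cdW : ∀ j, Continuous (pderiv j W) := fun j => continuous_pderiv hW (by simp) j
  have cddW : ∀ j, Continuous (pderiv j (pderiv j W)) := fun j =>
    continuous_pderiv (contDiff_pderiv hW j) (by simp) j
  have hj := fun j => viscous_pairing_dir_le hW hφ hφc hφ0 hc j
  have i1 : ∀ j, Integrable fun x => φ x ^ 4 * (W x * pderiv j (pderiv j W) x) := fun j =>
    integrable_pow_mul_of_continuous hφcont hφc (cW.mul (cddW j)) (by norm_num)
  have i2 : ∀ j, Integrable fun x => φ x ^ 4 * pderiv j W x ^ 2 := fun j =>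
    integrable_pow_mul_of_continuous hφcont hφc ((cdW j).pow 2) (by norm_num)
  have e1 : ∫ x, φ x ^ 4 * (W x * ∑ j, pderiv j (pderiv j W) x) =
      ∑ j, ∫ x, φ x ^ 4 * (W x * pderiv j (pderiv j W) x) := by
    rw [← integral_finsetSum _ fun j _ => i1 j]
    exact integral_congr_ae (Eventually.of_forall fun x => by
      simp only [Finset.mul_sum])
  have e2 : ∫ x, φ x ^ 4 * ∑ j, pderiv j W x ^ 2 = ∑ j, ∫ x, φ x ^ 4 * pderiv j W x ^ 2 := by
    rw [← integral_finsetSum _ fun j _ => i2 j]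
    exact integral_congr_ae (Eventually.of_forall fun x => by simp only [Finset.mul_sum])
  rw [e1, e2, Finset.mul_sum, Finset.mul_sum]
  calc ∑ j, 2 * ∫ x, φ x ^ 4 * (W x * pderiv j (pderiv j W) x)
      ≤ ∑ j, (-(3 / 2) * (∫ x, φ x ^ 4 * pderiv j W x ^ 2) +
          32 * c ^ 2 * ∫ x, φ x ^ 2 * W x ^ 2) := Finset.sum_le_sum fun j _ => hj j
    _ = ∑ j, -(3 / 2) * (∫ x, φ x ^ 4 * pderiv j W x ^ 2) +
          32 * c ^ 2 * Fintype.card ι * ∫ x, φ x ^ 2 * W x ^ 2 := by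
        rw [Finset.sum_add_distrib, Finset.sum_const, Finset.card_univ, nsmul_eq_mul]
        ring

/-- **The transport pairing is a cutoff error**: for smooth `W`, a smooth divergence-free `v`
and a smooth compactly supported weight `φ`,
`-2 ∫ φ⁴ W (v·∇W) = ∫ 4 φ³ (∇φ·v) W²` (integration by parts of `∫ φ⁴ vⱼ ∂ⱼ(W²)`; the term
`φ⁴ (div v) W²` vanishes). [folklore] -/
theorem transport_pairing_eq {W φ : EuclideanSpace ℝ ι → ℝ} {v : EuclideanSpace ℝ ι → EuclideanSpace ℝ ι} (hW : ContDiff ℝ ∞ W)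
    (hv : ContDiff ℝ ∞ v) (hdiv : ∀ x, ∑ j, pderiv j (fun y => v y j) x = 0)
    (hφ : ContDiff ℝ ∞ φ) (hφc : HasCompactSupport φ) :
    -2 * ∫ x, φ x ^ 4 * (W x * ∑ j, v x j * pderiv j W x) =
      ∫ x, 4 * φ x ^ 3 * (∑ j, pderiv j φ x * v x j) * W x ^ 2 := by
  have hφcont : Continuous φ := hφ.continuous
  have hφd : Differentiable ℝ φ := hφ.differentiable (by simp)
  have hWd : Differentiable ℝ W := hW.differentiable (by simp)
  have hV : ∀ j, ContDiff ℝ ∞ fun y => v y j := fun j => contDiff_comp_of_contDiff hv j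
  have hVd : ∀ j, Differentiable ℝ fun y => v y j := fun j => (hV j).differentiable (by simp)
  have hφ4 : ContDiff ℝ ∞ fun y => φ y ^ 4 := hφ.pow 4
  have hφ4d : Differentiable ℝ (fun y => φ y ^ 4) := hφd.pow 4
  have cW : Continuous W := hW.continuous
  have cdW : ∀ j, Continuous (pderiv j W) := fun j => continuous_pderiv hW (by simp) j
  have cV : ∀ j, Continuous fun y => v y j := fun j => (hV j).continuous
  have cdV : ∀ j, Continuous (pderiv j fun y => v y j) := fun j => continuous_pderiv (hV j) (by simp) j
  have cdφ : ∀ j, Continuous (pderiv j φ) := fun j => continuous_pderiv hφ (by simp) j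
  -- `∂ⱼ(W²) = 2 W ∂ⱼW` and `∂ⱼ(φ⁴ vⱼ) = 4φ³∂ⱼφ vⱼ + φ⁴ ∂ⱼvⱼ`
  have hsq : ∀ j x, pderiv j (fun y => W y * W y) x = 2 * (W x * pderiv j W x) := fun j x => by
    rw [pderiv_mul hWd hWd]
    ring
  have hprod : ∀ j x, pderiv j (fun y => φ y ^ 4 * v y j) x =
      4 * φ x ^ 3 * pderiv j φ x * v x j + φ x ^ 4 * pderiv j (fun y => v y j) x := fun j x => by
    have e := congrFun (pderiv_mul (f := fun y => φ y ^ 4) (g := fun y => v y j) hφ4d (hVd j) j) x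
    simp only at e
    rw [e, pderiv_pow_four hφd]
  -- integration by parts in each direction
  have hIBP : ∀ j, ∫ x, φ x ^ 4 * v x j * pderiv j (fun y => W y * W y) x =
      -∫ x, (4 * φ x ^ 3 * pderiv j φ x * v x j + φ x ^ 4 * pderiv j (fun y => v y j) x) *
        (W x * W x) := by
    intro j
    rw [integral_mul_pderiv_eq_neg (ψ := fun y => φ y ^ 4 * v y j)
      ((hφ4.mul (hV j)).of_le (by exact_mod_cast le_top))
      ((hasCompactSupport_pow hφc (by norm_num : (4:ℕ) ≠ 0)).mul_right)
      ((hW.mul hW).of_le (by exact_mod_cast le_top)) j]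
    congr 1
    exact integral_congr_ae (Eventually.of_forall fun x => by simp only [hprod])
  -- sum over `j`
  have iL : ∀ j, Integrable fun x => φ x ^ 4 * v x j * pderiv j (fun y => W y * W y) x := by
    intro j
    have : (fun x => φ x ^ 4 * v x j * pderiv j (fun y => W y * W y) x) =
        fun x => φ x ^ 4 * (v x j * (2 * (W x * pderiv j W x))) := by
      funext x; rw [hsq]; ring
    rw [this]
    exact integrable_pow_mul_of_continuous hφcont hφc
      ((cV j).mul (continuous_const.mul (cW.mul (cdW j)))) (by norm_num)
  have iR₁ : ∀ j, Integrable fun x => 4 * φ x ^ 3 * pderiv j φ x * v x j * (W x * W x) := by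
    intro j
    have : (fun x => 4 * φ x ^ 3 * pderiv j φ x * v x j * (W x * W x)) =
        fun x => φ x ^ 3 * (4 * pderiv j φ x * v x j * (W x * W x)) := by
      funext x; ring
    rw [this]
    exact integrable_pow_mul_of_continuous hφcont hφc
      (((continuous_const.mul (cdφ j)).mul (cV j)).mul (cW.mul cW)) (by norm_num)
  have iR₂ : ∀ j, Integrable fun x => φ x ^ 4 * pderiv j (fun y => v y j) x * (W x * W x) := by
    intro j
    have : (fun x => φ x ^ 4 * pderiv j (fun y => v y j) x * (W x * W x)) =
        fun x => φ x ^ 4 * (pderiv j (fun y => v y j) x * (W x * W x)) := by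
      funext x; ring
    rw [this]
    exact integrable_pow_mul_of_continuous hφcont hφc ((cdV j).mul (cW.mul cW)) (by norm_num)
  -- LHS as a sum of the IBP left sides
  have eL : -2 * ∫ x, φ x ^ 4 * (W x * ∑ j, v x j * pderiv j W x) =
      -∑ j, ∫ x, φ x ^ 4 * v x j * pderiv j (fun y => W y * W y) x := by
    rw [← integral_finsetSum _ fun j _ => iL j, ← integral_const_mul, ← integral_neg]
    refine integral_congr_ae (Eventually.of_forall fun x => ?_)
    simp only [hsq, Finset.mul_sum, ← Finset.sum_neg_distrib]
    exact Finset.sum_congr rfl fun j _ => by ring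
  -- the divergence term vanishes
  have ediv : ∑ j, ∫ x, φ x ^ 4 * pderiv j (fun y => v y j) x * (W x * W x) = 0 := by
    rw [← integral_finsetSum _ fun j _ => iR₂ j]
    refine (integral_congr_ae (Eventually.of_forall fun x => ?_)).trans (integral_zero _ _)
    simp only
    have : ∑ j, φ x ^ 4 * pderiv j (fun y => v y j) x * (W x * W x) =
        φ x ^ 4 * (∑ j, pderiv j (fun y => v y j) x) * (W x * W x) := by
      rw [Finset.mul_sum, Finset.sum_mul]
    rw [this, hdiv x]
    ring
  have eR : ∫ x, 4 * φ x ^ 3 * (∑ j, pderiv j φ x * v x j) * W x ^ 2 =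
      ∑ j, ∫ x, 4 * φ x ^ 3 * pderiv j φ x * v x j * (W x * W x) := by
    rw [← integral_finsetSum _ fun j _ => iR₁ j]
    refine integral_congr_ae (Eventually.of_forall fun x => ?_)
    simp only [Finset.mul_sum, Finset.sum_mul]
    exact Finset.sum_congr rfl fun j _ => by ring
  rw [eL, eR]
  have : ∀ j, ∫ x, φ x ^ 4 * v x j * pderiv j (fun y => W y * W y) x =
      -((∫ x, 4 * φ x ^ 3 * pderiv j φ x * v x j * (W x * W x)) +
        ∫ x, φ x ^ 4 * pderiv j (fun y => v y j) x * (W x * W x)) := fun j => by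
    rw [hIBP j, ← integral_add (iR₁ j) (iR₂ j)]
    congr 1
    exact integral_congr_ae (Eventually.of_forall fun x => by simp only; ring)
  simp only [this, Finset.sum_neg_distrib, neg_neg, Finset.sum_add_distrib, ediv, add_zero]

/-- **Bound for the transport cutoff error**: with `0 ≤ φ`, `|∂φ| ≤ c`,
`4 φ³ (∇φ·v) W² ≤ 4 c (card ι) φ³ ‖v‖ W²` pointwise. [folklore] -/
theorem transport_error_pointwise_le {φ W : EuclideanSpace ℝ ι → ℝ} {v : EuclideanSpace ℝ ι → EuclideanSpace ℝ ι} (hφ0 : ∀ x, 0 ≤ φ x) {c : ℝ}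
    (hc : ∀ l x, |pderiv l φ x| ≤ c) (x : EuclideanSpace ℝ ι) :
    4 * φ x ^ 3 * (∑ j, pderiv j φ x * v x j) * W x ^ 2 ≤
      4 * c * Fintype.card ι * (φ x ^ 3 * (‖v x‖ * W x ^ 2)) := by
  have h1 : |∑ j, pderiv j φ x * v x j| ≤ Fintype.card ι * (c * ‖v x‖) := by
    refine (Finset.abs_sum_le_sum_abs _ _).trans ?_
    calc ∑ j, |pderiv j φ x * v x j| ≤ ∑ _j : ι, c * ‖v x‖ := Finset.sum_le_sum fun j _ => by
          rw [abs_mul]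
          exact mul_le_mul (hc j x) (by simpa using PiLp.norm_apply_le (v x) j) (abs_nonneg _)
            ((abs_nonneg _).trans (hc j x))
      _ = Fintype.card ι * (c * ‖v x‖) := by
          rw [Finset.sum_const, Finset.card_univ, nsmul_eq_mul]
  have h0 : 0 ≤ 4 * φ x ^ 3 * W x ^ 2 := by
    have := hφ0 x; positivity
  calc 4 * φ x ^ 3 * (∑ j, pderiv j φ x * v x j) * W x ^ 2
      = (4 * φ x ^ 3 * W x ^ 2) * (∑ j, pderiv j φ x * v x j) := by ring
    _ ≤ (4 * φ x ^ 3 * W x ^ 2) * |∑ j, pderiv j φ x * v x j| :=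
        mul_le_mul_of_nonneg_left (le_abs_self _) h0
    _ ≤ (4 * φ x ^ 3 * W x ^ 2) * (Fintype.card ι * (c * ‖v x‖)) :=
        mul_le_mul_of_nonneg_left h1 h0
    _ = 4 * c * Fintype.card ι * (φ x ^ 3 * (‖v x‖ * W x ^ 2)) := by ring

end Scalar

/-! ## Weighted fields `φ² • F`: norms and derivatives -/

section Weighted

variable {X : Type*} [NormedAddCommGroup X] [NormedSpace ℝ X]
variable {G : Type*} [NormedAddCommGroup G] [NormedSpace ℝ G]

/-- Product-rule bound: `‖D(w • F)(x)‖ ≤ |w(x)| ‖DF(x)‖ + ‖Dw(x)‖ ‖F(x)‖`. [folklore] -/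
theorem norm_fderiv_smul_le {w : X → ℝ} {F : X → G} {x : X} (hw : DifferentiableAt ℝ w x)
    (hF : DifferentiableAt ℝ F x) :
    ‖fderiv ℝ (fun y => w y • F y) x‖ ≤ |w x| * ‖fderiv ℝ F x‖ + ‖fderiv ℝ w x‖ * ‖F x‖ := by
  rw [fderiv_fun_smul hw hF]
  refine (norm_add_le _ _).trans (add_le_add ?_ ?_)
  · rw [norm_smul, Real.norm_eq_abs]
  · exact (ContinuousLinearMap.norm_smulRight_apply _ _).le

/-- Squared form: `‖D(w • F)(x)‖² ≤ 2 w(x)² ‖DF(x)‖² + 2 ‖Dw(x)‖² ‖F(x)‖²`. [folklore] -/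
theorem sq_norm_fderiv_smul_le {w : X → ℝ} {F : X → G} {x : X} (hw : DifferentiableAt ℝ w x)
    (hF : DifferentiableAt ℝ F x) :
    ‖fderiv ℝ (fun y => w y • F y) x‖ ^ 2 ≤
      2 * (w x ^ 2 * ‖fderiv ℝ F x‖ ^ 2) + 2 * (‖fderiv ℝ w x‖ ^ 2 * ‖F x‖ ^ 2) := by
  have h := norm_fderiv_smul_le hw hF
  calc ‖fderiv ℝ (fun y => w y • F y) x‖ ^ 2
      ≤ (|w x| * ‖fderiv ℝ F x‖ + ‖fderiv ℝ w x‖ * ‖F x‖) ^ 2 :=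
        pow_le_pow_left₀ (norm_nonneg _) h 2
    _ ≤ 2 * (|w x| * ‖fderiv ℝ F x‖) ^ 2 + 2 * (‖fderiv ℝ w x‖ * ‖F x‖) ^ 2 := by
        nlinarith [sq_nonneg (|w x| * ‖fderiv ℝ F x‖ - ‖fderiv ℝ w x‖ * ‖F x‖)]
    _ = _ := by rw [mul_pow, mul_pow, sq_abs]

/-- `‖D(φ²)(x)‖ ≤ 2 φ(x) c` when `0 ≤ φ(x)` and `‖Dφ(x)‖ ≤ c`. [folklore] -/
theorem norm_fderiv_pow_two_le {φ : X → ℝ} {x : X} (hφ : DifferentiableAt ℝ φ x) (hφ0 : 0 ≤ φ x)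
    {c : ℝ} (hc : ‖fderiv ℝ φ x‖ ≤ c) : ‖fderiv ℝ (fun y => φ y ^ 2) x‖ ≤ 2 * φ x * c := by
  have e : (fun y => φ y ^ 2) = fun y => φ y * φ y := funext fun y => sq (φ y)
  rw [e, fderiv_fun_mul hφ hφ, ← two_smul ℝ (φ x • fderiv ℝ φ x), smul_smul, norm_smul,
    Real.norm_of_nonneg (by positivity)]
  exact mul_le_mul_of_nonneg_left hc (by positivity)

/-- **`‖D(φ² • F)(x)‖² ≤ 2 φ⁴ ‖DF‖² + 8 c² φ² ‖F‖²`** (`0 ≤ φ`, `‖Dφ‖ ≤ c`). [folklore] -/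
theorem sq_norm_fderiv_sq_smul_le {φ : X → ℝ} {F : X → G} {x : X} (hφ : DifferentiableAt ℝ φ x)
    (hF : DifferentiableAt ℝ F x) (hφ0 : 0 ≤ φ x) {c : ℝ} (hc : ‖fderiv ℝ φ x‖ ≤ c) :
    ‖fderiv ℝ (fun y => φ y ^ 2 • F y) x‖ ^ 2 ≤
      2 * (φ x ^ 4 * ‖fderiv ℝ F x‖ ^ 2) + 8 * c ^ 2 * (φ x ^ 2 * ‖F x‖ ^ 2) := by
  have h1 := sq_norm_fderiv_smul_le (w := fun y => φ y ^ 2) (hφ.pow 2) hF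
  have h2 := norm_fderiv_pow_two_le hφ hφ0 hc
  have h3 : ‖fderiv ℝ (fun y => φ y ^ 2) x‖ ^ 2 ≤ (2 * φ x * c) ^ 2 :=
    pow_le_pow_left₀ (norm_nonneg _) h2 2
  calc ‖fderiv ℝ (fun y => φ y ^ 2 • F y) x‖ ^ 2
      ≤ 2 * ((φ x ^ 2) ^ 2 * ‖fderiv ℝ F x‖ ^ 2) +
          2 * (‖fderiv ℝ (fun y => φ y ^ 2) x‖ ^ 2 * ‖F x‖ ^ 2) := h1
    _ ≤ 2 * ((φ x ^ 2) ^ 2 * ‖fderiv ℝ F x‖ ^ 2) + 2 * ((2 * φ x * c) ^ 2 * ‖F x‖ ^ 2) := by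
        gcongr
    _ = _ := by ring

omit [NormedAddCommGroup X] [NormedSpace ℝ X] in
/-- `‖φ(x)² • F(x)‖² = φ(x)⁴ ‖F(x)‖²`. [folklore] -/
theorem sq_norm_sq_smul {X : Type*} (φ : X → ℝ) (F : X → G) (x : X) :
    ‖φ x ^ 2 • F x‖ ^ 2 = φ x ^ 4 * ‖F x‖ ^ 2 := by
  rw [norm_smul, Real.norm_of_nonneg (sq_nonneg _)]
  ring

omit [NormedAddCommGroup X] [NormedSpace ℝ X] in
/-- `‖φ(x) • F(x)‖² = φ(x)² ‖F(x)‖²`. [folklore] -/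
theorem sq_norm_smul' {X : Type*} (φ : X → ℝ) (F : X → G) (x : X) :
    ‖φ x • F x‖ ^ 2 = φ x ^ 2 * ‖F x‖ ^ 2 := by
  rw [norm_smul, Real.norm_eq_abs, mul_pow, sq_abs]

variable {ι : Type*} [Fintype ι] [DecidableEq ι]


omit [DecidableEq ι] in
/-- **Integrated form**: for a smooth compactly supported weight `0 ≤ φ` with `‖Dφ‖ ≤ c` and a
`C¹` field `F`, `∫ ‖D(φ² • F)‖² ≤ 2 ∫ φ⁴ ‖DF‖² + 8 c² ∫ φ² ‖F‖²`. [folklore] -/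
theorem integral_sq_norm_fderiv_sq_smul_le {φ : EuclideanSpace ℝ ι → ℝ} {F : EuclideanSpace ℝ ι → G} (hφ : ContDiff ℝ ∞ φ)
    (hφc : HasCompactSupport φ) (hφ0 : ∀ x, 0 ≤ φ x) {c : ℝ} (hc : ∀ x, ‖fderiv ℝ φ x‖ ≤ c)
    (hF : ContDiff ℝ 1 F) :
    ∫ x, ‖fderiv ℝ (fun y => φ y ^ 2 • F y) x‖ ^ 2 ≤
      2 * (∫ x, φ x ^ 4 * ‖fderiv ℝ F x‖ ^ 2) + 8 * c ^ 2 * ∫ x, φ x ^ 2 * ‖F x‖ ^ 2 := by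
  have i1 : Integrable fun x => φ x ^ 4 * ‖fderiv ℝ F x‖ ^ 2 :=
    integrable_pow_mul_of_continuous hφ.continuous hφc
      ((hF.continuous_fderiv one_ne_zero).norm.pow 2) (by norm_num)
  have i2 : Integrable fun x => φ x ^ 2 * ‖F x‖ ^ 2 :=
    integrable_pow_mul_of_continuous hφ.continuous hφc (hF.continuous.norm.pow 2) (by norm_num)
  calc ∫ x, ‖fderiv ℝ (fun y => φ y ^ 2 • F y) x‖ ^ 2
      ≤ ∫ x, (2 * (φ x ^ 4 * ‖fderiv ℝ F x‖ ^ 2) + 8 * c ^ 2 * (φ x ^ 2 * ‖F x‖ ^ 2)) := by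
        refine integral_mono_of_nonneg (Eventually.of_forall fun x => sq_nonneg _)
          ((i1.const_mul _).add (i2.const_mul _)) (Eventually.of_forall fun x => ?_)
        exact sq_norm_fderiv_sq_smul_le ((hφ.differentiable (by simp)) x)
          ((hF.differentiable one_ne_zero) x) (hφ0 x) (hc x)
    _ = _ := by
        rw [integral_add (i1.const_mul _) (i2.const_mul _), integral_const_mul,
          integral_const_mul]

omit [DecidableEq ι] in
/-- The same with a scalar weight `φ'` to the first power: `∫ ‖D(φ' • F)‖² ≤ 2 ∫ φ'² ‖DF‖² +
2 c² ∫ ‖F‖²` when `‖Dφ'‖ ≤ c` and `‖F‖²` is integrable. [folklore] -/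
theorem integral_sq_norm_fderiv_smul_le {φ' : EuclideanSpace ℝ ι → ℝ} {F : EuclideanSpace ℝ ι → G} (hφ : ContDiff ℝ ∞ φ')
    (hφc : HasCompactSupport φ') {c : ℝ} (hc : ∀ x, ‖fderiv ℝ φ' x‖ ≤ c)
    (hF : ContDiff ℝ 1 F) (hFi : Integrable fun x => ‖F x‖ ^ 2) :
    ∫ x, ‖fderiv ℝ (fun y => φ' y • F y) x‖ ^ 2 ≤
      2 * (∫ x, φ' x ^ 2 * ‖fderiv ℝ F x‖ ^ 2) + 2 * c ^ 2 * ∫ x, ‖F x‖ ^ 2 := by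
  have i1 : Integrable fun x => φ' x ^ 2 * ‖fderiv ℝ F x‖ ^ 2 :=
    integrable_pow_mul_of_continuous hφ.continuous hφc
      ((hF.continuous_fderiv one_ne_zero).norm.pow 2) (by norm_num)
  have hc0 : ∀ x, 0 ≤ c := fun x => (norm_nonneg _).trans (hc x)
  calc ∫ x, ‖fderiv ℝ (fun y => φ' y • F y) x‖ ^ 2
      ≤ ∫ x, (2 * (φ' x ^ 2 * ‖fderiv ℝ F x‖ ^ 2) + 2 * c ^ 2 * ‖F x‖ ^ 2) := by
        refine integral_mono_of_nonneg (Eventually.of_forall fun x => sq_nonneg _)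
          ((i1.const_mul _).add (hFi.const_mul _)) (Eventually.of_forall fun x => ?_)
        refine (sq_norm_fderiv_smul_le ((hφ.differentiable (by simp)) x)
          ((hF.differentiable one_ne_zero) x)).trans ?_
        have : ‖fderiv ℝ φ' x‖ ^ 2 ≤ c ^ 2 := pow_le_pow_left₀ (norm_nonneg _) (hc x) 2
        nlinarith [sq_nonneg ‖F x‖]
    _ = _ := by
        rw [integral_add (i1.const_mul _) (hFi.const_mul _), integral_const_mul,
          integral_const_mul]

/-! ### The weighted bundled families `φ² • (∂^γ vᵢ)_{(γ,i)}`, `φ² • (∂^β Ω_{ki})_{(β,k,i)}` -/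

variable {v : EuclideanSpace ℝ ι → EuclideanSpace ℝ ι} {φ : EuclideanSpace ℝ ι → ℝ}

/-- `∫ ‖φ² • famVec (levelFam b v)‖² = ∫ φ⁴ |∇ᵇ v|²`. [folklore] -/
theorem integral_sq_norm_sq_smul_famVec_levelFam (b : ℕ) :
    ∫ x, ‖φ x ^ 2 • famVec (levelFam b v) x‖ ^ 2 = ∫ x, φ x ^ 4 * levelSq b v x :=
  integral_congr_ae (Eventually.of_forall fun x => by
    simp only [sq_norm_sq_smul, sq_norm_famVec_levelFam])

/-- `∫ ‖φ² • famVec (vortFam n v)‖² = ∫ φ⁴ |∇ⁿ Ω|²`. [folklore] -/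
theorem integral_sq_norm_sq_smul_famVec_vortFam (n : ℕ) :
    ∫ x, ‖φ x ^ 2 • famVec (vortFam n v) x‖ ^ 2 = ∫ x, φ x ^ 4 * vortSq n v x :=
  integral_congr_ae (Eventually.of_forall fun x => by
    simp only [sq_norm_sq_smul, sq_norm_famVec_vortFam])

/-- `∫ ‖D(φ² • famVec (levelFam b v))‖² ≤ 2 ∫ φ⁴ |∇^{b+1} v|² + 8 c² ∫ φ² |∇ᵇ v|²`. [folklore] -/
theorem integral_sq_norm_fderiv_sq_smul_famVec_levelFam_le (hv : ContDiff ℝ ∞ v)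
    (hφ : ContDiff ℝ ∞ φ) (hφc : HasCompactSupport φ) (hφ0 : ∀ x, 0 ≤ φ x) {c : ℝ}
    (hc : ∀ x, ‖fderiv ℝ φ x‖ ≤ c) (b : ℕ) :
    ∫ x, ‖fderiv ℝ (fun y => φ y ^ 2 • famVec (levelFam b v) y) x‖ ^ 2 ≤
      2 * (∫ x, φ x ^ 4 * levelSq (b + 1) v x) + 8 * c ^ 2 * ∫ x, φ x ^ 2 * levelSq b v x := by
  have hF : ContDiff ℝ 1 (famVec (levelFam b v)) :=
    (contDiff_famVec fun c => contDiff_levelFam hv b c).of_le (by exact_mod_cast le_top)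
  refine (integral_sq_norm_fderiv_sq_smul_le hφ hφc hφ0 hc hF).trans ?_
  have e2 : ∫ x, φ x ^ 2 * ‖famVec (levelFam b v) x‖ ^ 2 = ∫ x, φ x ^ 2 * levelSq b v x :=
    integral_congr_ae (Eventually.of_forall fun x => by simp only [sq_norm_famVec_levelFam])
  have i1 : Integrable fun x => φ x ^ 4 * levelSq (b + 1) v x :=
    integrable_pow_mul_of_continuous hφ.continuous hφc (continuous_levelSq hv _) (by norm_num)
  have i0 : Integrable fun x => φ x ^ 4 * ‖fderiv ℝ (famVec (levelFam b v)) x‖ ^ 2 :=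
    integrable_pow_mul_of_continuous hφ.continuous hφc
      ((hF.continuous_fderiv one_ne_zero).norm.pow 2) (by norm_num)
  have h1 : ∫ x, φ x ^ 4 * ‖fderiv ℝ (famVec (levelFam b v)) x‖ ^ 2 ≤
      ∫ x, φ x ^ 4 * levelSq (b + 1) v x :=
    integral_mono i0 i1 fun x => mul_le_mul_of_nonneg_left
      (sq_norm_fderiv_famVec_levelFam_le hv b x) (pow_nonneg (hφ0 x) 4)
  rw [e2]
  linarith

/-- `∫ ‖D(φ² • famVec (vortFam n v))‖² ≤ 2 ∫ φ⁴ |∇^{n+1} Ω|² + 8 c² ∫ φ² |∇ⁿ Ω|²`. [folklore] -/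
theorem integral_sq_norm_fderiv_sq_smul_famVec_vortFam_le (hv : ContDiff ℝ ∞ v)
    (hφ : ContDiff ℝ ∞ φ) (hφc : HasCompactSupport φ) (hφ0 : ∀ x, 0 ≤ φ x) {c : ℝ}
    (hc : ∀ x, ‖fderiv ℝ φ x‖ ≤ c) (n : ℕ) :
    ∫ x, ‖fderiv ℝ (fun y => φ y ^ 2 • famVec (vortFam n v) y) x‖ ^ 2 ≤
      2 * (∫ x, φ x ^ 4 * vortSq (n + 1) v x) + 8 * c ^ 2 * ∫ x, φ x ^ 2 * vortSq n v x := by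
  have hF : ContDiff ℝ 1 (famVec (vortFam n v)) :=
    (contDiff_famVec fun c => contDiff_vortFam hv n c).of_le (by exact_mod_cast le_top)
  refine (integral_sq_norm_fderiv_sq_smul_le hφ hφc hφ0 hc hF).trans ?_
  have e2 : ∫ x, φ x ^ 2 * ‖famVec (vortFam n v) x‖ ^ 2 = ∫ x, φ x ^ 2 * vortSq n v x :=
    integral_congr_ae (Eventually.of_forall fun x => by simp only [sq_norm_famVec_vortFam])
  have i1 : Integrable fun x => φ x ^ 4 * vortSq (n + 1) v x :=
    integrable_pow_mul_of_continuous hφ.continuous hφc (continuous_vortSq hv _) (by norm_num)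
  have i0 : Integrable fun x => φ x ^ 4 * ‖fderiv ℝ (famVec (vortFam n v)) x‖ ^ 2 :=
    integrable_pow_mul_of_continuous hφ.continuous hφc
      ((hF.continuous_fderiv one_ne_zero).norm.pow 2) (by norm_num)
  have h1 : ∫ x, φ x ^ 4 * ‖fderiv ℝ (famVec (vortFam n v)) x‖ ^ 2 ≤
      ∫ x, φ x ^ 4 * vortSq (n + 1) v x :=
    integral_mono i0 i1 fun x => mul_le_mul_of_nonneg_left
      (sq_norm_fderiv_famVec_vortFam_le hv n x) (pow_nonneg (hφ0 x) 4)
  rw [e2]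
  linarith

/-- `∫ φ² |∇ⁿ Ω|² ≤ 4 ∫ φ² |∇^{n+1} v|²`. [folklore] -/
theorem integral_sq_mul_vortSq_le (hv : ContDiff ℝ ∞ v) (hφ : ContDiff ℝ ∞ φ)
    (hφc : HasCompactSupport φ) (n : ℕ) :
    ∫ x, φ x ^ 2 * vortSq n v x ≤ 4 * ∫ x, φ x ^ 2 * levelSq (n + 1) v x := by
  rw [← integral_const_mul]
  refine integral_mono
    (integrable_pow_mul_of_continuous hφ.continuous hφc (continuous_vortSq hv _) (by norm_num))
    ((integrable_pow_mul_of_continuous hφ.continuous hφc (continuous_levelSq hv _)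
      (by norm_num)).const_mul _) fun x => ?_
  have := vortSq_le_four_mul_levelSq_succ hv n x
  have h0 : 0 ≤ φ x ^ 2 := sq_nonneg _
  nlinarith

omit [DecidableEq ι] in
/-- `∫ φ⁴ g ≤ ∫ φ² g` for `0 ≤ φ ≤ 1` and continuous `g ≥ 0`. [folklore] -/
theorem integral_pow_four_mul_le_integral_sq_mul {g : EuclideanSpace ℝ ι → ℝ} (hg : Continuous g)
    (hg0 : ∀ x, 0 ≤ g x) (hφ : ContDiff ℝ ∞ φ) (hφc : HasCompactSupport φ)
    (hφ0 : ∀ x, 0 ≤ φ x) (hφ1 : ∀ x, φ x ≤ 1) :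
    ∫ x, φ x ^ 4 * g x ≤ ∫ x, φ x ^ 2 * g x := by
  refine integral_mono (integrable_pow_mul_of_continuous hφ.continuous hφc hg (by norm_num))
    (integrable_pow_mul_of_continuous hφ.continuous hφc hg (by norm_num)) fun x => ?_
  refine mul_le_mul_of_nonneg_right ?_ (hg0 x)
  calc φ x ^ 4 = φ x ^ 2 * φ x ^ 2 := by ring
    _ ≤ φ x ^ 2 * 1 := mul_le_mul_of_nonneg_left (pow_le_one₀ (hφ0 x) (hφ1 x)) (sq_nonneg _)
    _ = φ x ^ 2 := mul_one _

omit [DecidableEq ι] in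
/-- `∫ φʲ g ≤ ∫ g` for `0 ≤ φ ≤ 1`, `j ≥ 1`, and integrable continuous `g ≥ 0`. [folklore] -/
theorem integral_pow_mul_le_integral {g : EuclideanSpace ℝ ι → ℝ} (hg : Continuous g) (hg0 : ∀ x, 0 ≤ g x)
    (hgi : Integrable g) (hφ : ContDiff ℝ ∞ φ) (hφc : HasCompactSupport φ)
    (hφ0 : ∀ x, 0 ≤ φ x) (hφ1 : ∀ x, φ x ≤ 1) {j : ℕ} (hj : j ≠ 0) :
    ∫ x, φ x ^ j * g x ≤ ∫ x, g x := by
  refine integral_mono (integrable_pow_mul_of_continuous hφ.continuous hφc hg hj) hgi fun x => ?_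
  calc φ x ^ j * g x ≤ 1 * g x :=
        mul_le_mul_of_nonneg_right (pow_le_one₀ (hφ0 x) (hφ1 x)) (hg0 x)
    _ = g x := one_mul _

end Weighted

/-! ## Elementary absorption lemmas (choice of the Young parameter `ε`) -/

section Absorb

/-- Absorption for the forcing terms: given `A, p, q₀, q₁ ≥ 0` and `ν > 0` there are `ε > 0` and
`C ≥ 0` with `A (⅛ ε⁻³ (p + Y + X) + ⅜ ε (4 D + q₁ Y + q₀)) ≤ (ν/4) D + C (1 + X + Y)` for all
`X, Y, D ≥ 0` (take `ε = ν / (6A + 1)`). [folklore] -/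
theorem exists_eps_absorb_four {A p q₀ q₁ ν : ℝ} (hA : 0 ≤ A) (hp : 0 ≤ p) (hq₀ : 0 ≤ q₀)
    (hq₁ : 0 ≤ q₁) (hν : 0 < ν) :
    ∃ ε : ℝ, 0 < ε ∧ ∃ C : ℝ, 0 ≤ C ∧ ∀ X Y D : ℝ, 0 ≤ X → 0 ≤ Y → 0 ≤ D →
      A * (1 / 8 * (ε⁻¹ ^ 3 * (p + Y + X)) + 3 / 8 * (ε * (4 * D + q₁ * Y + q₀))) ≤
        ν / 4 * D + C * (1 + X + Y) := by
  set ε : ℝ := ν / (6 * A + 1) with hε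
  have hε0 : 0 < ε := div_pos hν (by positivity)
  refine ⟨ε, hε0, A * (1 / 8 * (ε⁻¹ ^ 3 * (p + 1)) + 3 / 8 * (ε * (q₁ + q₀))), by positivity,
    fun X Y D hX hY hD => ?_⟩
  have hεA : A * (3 / 8 * (ε * 4)) ≤ ν / 4 := by
    rw [hε]
    have h6 : 0 < 6 * A + 1 := by positivity
    rw [show A * (3 / 8 * (ν / (6 * A + 1) * 4)) = (6 * A) / (6 * A + 1) * (ν / 4) by ring]
    have : (6 * A) / (6 * A + 1) ≤ 1 := by rw [div_le_one h6]; linarith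
    nlinarith
  have hi : 0 ≤ ε⁻¹ ^ 3 := by positivity
  -- expand and compare term by term
  have e : A * (1 / 8 * (ε⁻¹ ^ 3 * (p + Y + X)) + 3 / 8 * (ε * (4 * D + q₁ * Y + q₀))) =
      A * (3 / 8 * (ε * 4)) * D + (A * (1 / 8 * (ε⁻¹ ^ 3 * p)) + A * (3 / 8 * (ε * q₀))) +
        A * (1 / 8 * ε⁻¹ ^ 3) * X + (A * (1 / 8 * ε⁻¹ ^ 3) + A * (3 / 8 * (ε * q₁))) * Y := by
    ring
  rw [e]
  have t1 : A * (3 / 8 * (ε * 4)) * D ≤ ν / 4 * D := mul_le_mul_of_nonneg_right hεA hD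
  set C := A * (1 / 8 * (ε⁻¹ ^ 3 * (p + 1)) + 3 / 8 * (ε * (q₁ + q₀))) with hC
  have t2 : A * (1 / 8 * (ε⁻¹ ^ 3 * p)) + A * (3 / 8 * (ε * q₀)) ≤ C := by
    rw [hC]; nlinarith [mul_nonneg hA hi, mul_nonneg hA hε0.le, mul_nonneg (mul_nonneg hA hε0.le) hq₁]
  have t3 : A * (1 / 8 * ε⁻¹ ^ 3) ≤ C := by
    rw [hC]
    nlinarith [mul_nonneg hA hi, mul_nonneg (mul_nonneg hA hi) hp,
      mul_nonneg (mul_nonneg hA hε0.le) (add_nonneg hq₁ hq₀)]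
  have t4 : A * (1 / 8 * ε⁻¹ ^ 3) + A * (3 / 8 * (ε * q₁)) ≤ C := by
    rw [hC]
    nlinarith [mul_nonneg hA hi, mul_nonneg (mul_nonneg hA hi) hp,
      mul_nonneg (mul_nonneg hA hε0.le) hq₀]
  have hC0 : 0 ≤ C := by rw [hC]; positivity
  nlinarith [mul_le_mul_of_nonneg_right t3 hX, mul_le_mul_of_nonneg_right t4 hY]

/-- Absorption for the transport term: given `A, s, q ≥ 0`, `κ ≥ 0` and `ν > 0` there are `ε > 0`
and `C ≥ 0` with `A (½ Y + ⅛ ε⁻³ (X s) + ⅜ ε ((2 D + κ Y) q)) ≤ (ν/4) D + C (X + Y)` for all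
`X, Y, D ≥ 0` (take `ε = ν / (3 A q + 1)`). [folklore] -/
theorem exists_eps_absorb_three {A s q κ ν : ℝ} (hA : 0 ≤ A) (hs : 0 ≤ s) (hq : 0 ≤ q)
    (hκ : 0 ≤ κ) (hν : 0 < ν) :
    ∃ ε : ℝ, 0 < ε ∧ ∃ C : ℝ, 0 ≤ C ∧ ∀ X Y D : ℝ, 0 ≤ X → 0 ≤ Y → 0 ≤ D →
      A * (1 / 2 * Y + 1 / 8 * (ε⁻¹ ^ 3 * (X * s)) + 3 / 8 * (ε * ((2 * D + κ * Y) * q))) ≤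
        ν / 4 * D + C * (X + Y) := by
  set ε : ℝ := ν / (3 * A * q + 1) with hε
  have hε0 : 0 < ε := div_pos hν (by positivity)
  refine ⟨ε, hε0, A * (1 / 2 + 3 / 8 * (ε * (κ * q))) + A * (1 / 8 * (ε⁻¹ ^ 3 * s)),
    by positivity, fun X Y D hX hY hD => ?_⟩
  have hεA : A * (3 / 8 * (ε * (2 * q))) ≤ ν / 4 := by
    rw [hε]
    have h3 : 0 < 3 * A * q + 1 := by positivity
    rw [show A * (3 / 8 * (ν / (3 * A * q + 1) * (2 * q))) =
      (3 * A * q) / (3 * A * q + 1) * (ν / 4) by ring]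
    have : (3 * A * q) / (3 * A * q + 1) ≤ 1 := by rw [div_le_one h3]; linarith
    nlinarith
  have hi : 0 ≤ ε⁻¹ ^ 3 := by positivity
  have e : A * (1 / 2 * Y + 1 / 8 * (ε⁻¹ ^ 3 * (X * s)) + 3 / 8 * (ε * ((2 * D + κ * Y) * q))) =
      A * (3 / 8 * (ε * (2 * q))) * D + A * (1 / 8 * (ε⁻¹ ^ 3 * s)) * X +
        A * (1 / 2 + 3 / 8 * (ε * (κ * q))) * Y := by ring
  rw [e]
  have t1 : A * (3 / 8 * (ε * (2 * q))) * D ≤ ν / 4 * D := mul_le_mul_of_nonneg_right hεA hD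
  have c1 : 0 ≤ A * (1 / 8 * (ε⁻¹ ^ 3 * s)) := by positivity
  have c2 : 0 ≤ A * (1 / 2 + 3 / 8 * (ε * (κ * q))) := by positivity
  nlinarith [mul_nonneg c1 hY, mul_nonneg c2 hX]

end Absorb

/-! ## The slice inequality on `ℝ³`: transport and forcing bounds -/

section SliceCore



variable {v : EuclideanSpace ℝ (Fin 3) → EuclideanSpace ℝ (Fin 3)} {φ : EuclideanSpace ℝ (Fin 3) → ℝ}

/-- `‖famVec (vortFam n v) x‖ = |∇ⁿ Ω (x)|`. [folklore] -/
theorem norm_famVec_vortFam (n : ℕ) (v : EuclideanSpace ℝ (Fin 3) → EuclideanSpace ℝ (Fin 3)) (x : EuclideanSpace ℝ (Fin 3)) :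
    ‖famVec (vortFam n v) x‖ = Real.sqrt (vortSq n v x) := by
  rw [← sq_norm_famVec_vortFam, Real.sqrt_sq (norm_nonneg _)]

/-- `‖famVec (levelFam m v) x‖ = |∇ᵐ v (x)|`. [folklore] -/
theorem norm_famVec_levelFam (m : ℕ) (v : EuclideanSpace ℝ (Fin 3) → EuclideanSpace ℝ (Fin 3)) (x : EuclideanSpace ℝ (Fin 3)) :
    ‖famVec (levelFam m v) x‖ = Real.sqrt (levelSq m v x) := by
  rw [← sq_norm_famVec_levelFam, Real.sqrt_sq (norm_nonneg _)]

/-- `‖Dv(x)‖² ≤ |∇v (x)|²` (operator norm versus the coordinate tensor). [folklore] -/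
theorem sq_norm_fderiv_le_levelSq_one (hv : ContDiff ℝ ∞ v) (x : EuclideanSpace ℝ (Fin 3)) :
    ‖fderiv ℝ v x‖ ^ 2 ≤ levelSq 1 v x := by
  have hV : ∀ i, ContDiff ℝ ∞ fun y => v y i := fun i => contDiff_comp_of_contDiff hv i
  have e : v = famVec fun i y => v y i := rfl
  have h := sq_norm_fderiv_famVec_le (g := fun i y => v y i)
    (fun i => (hV i).differentiable (by simp)) x
  rw [← e] at h
  refine h.trans (le_of_eq ?_)
  rw [levelSq, Finset.sum_comm]
  refine Finset.sum_congr rfl fun i _ => ?_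
  rw [dnormSq_succ (hV i)]
  simp only [dnormSq_zero]

/-- **The transport term.** Given `ν > 0`, the gradient bound `c` of the cutoffs and global bounds
`S₀ ≥ ∫ |v|²`, `S₁ ≥ ∫ |∇v|²`, there is `C` such that for every smooth `v` obeying these bounds,
every smooth compactly supported `0 ≤ φ ≤ 1` with `‖Dφ‖ ≤ c` and companion `φ'` (same, `= 1`
where `φ ≠ 0`), and every `n`,
`∫ 4φ³ (∇φ · v) |∇ⁿΩ|² ≤ (ν/4) ∫ φ⁴ |∇^{n+1}Ω|² + C (∫ φ⁴ |∇ⁿΩ|² + ∫ φ² |∇^{n+1}v|²)`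
(Hölder `L² · L⁴ · L⁴`-type trilinear bound via Gagliardo–Nirenberg–Sobolev, then Young).
[folklore] -/
theorem transport_term_le {ν c S₀ S₁ : ℝ} (hν : 0 < ν) (hc : 0 ≤ c) (hS₀ : 0 ≤ S₀)
    (hS₁ : 0 ≤ S₁) (n : ℕ) :
    ∃ C : ℝ, 0 ≤ C ∧ ∀ (v : EuclideanSpace ℝ (Fin 3) → EuclideanSpace ℝ (Fin 3)) (φ φ' : EuclideanSpace ℝ (Fin 3) → ℝ), ContDiff ℝ ∞ v →
      ContDiff ℝ ∞ φ → HasCompactSupport φ → (∀ x, 0 ≤ φ x) → (∀ x, φ x ≤ 1) →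
      (∀ x, ‖fderiv ℝ φ x‖ ≤ c) →
      ContDiff ℝ ∞ φ' → HasCompactSupport φ' → (∀ x, 0 ≤ φ' x) → (∀ x, φ' x ≤ 1) →
      (∀ x, ‖fderiv ℝ φ' x‖ ≤ c) → (∀ x, φ x ≠ 0 → φ' x = 1) →
      (Integrable fun x => ‖v x‖ ^ 2) → (∫ x, ‖v x‖ ^ 2 ≤ S₀) →
      Integrable (levelSq 1 v) → (∫ x, levelSq 1 v x ≤ S₁) →
      ∫ x, 4 * φ x ^ 3 * (∑ j, pderiv j φ x * v x j) * vortSq n v x ≤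
        ν / 4 * (∫ x, φ x ^ 4 * vortSq (n + 1) v x) +
          C * ((∫ x, φ x ^ 4 * vortSq n v x) + ∫ x, φ x ^ 2 * levelSq (n + 1) v x) := by
  have hK0 : 0 ≤ (((eLpNormLESNormFDerivOfEqInnerConst (volume : Measure (EuclideanSpace ℝ (Fin 3))) 2 : ℝ≥0) : ℝ)) := NNReal.coe_nonneg _
  obtain ⟨ε, hε, C, hC0, hC⟩ := exists_eps_absorb_three (A := 24 * c * (((eLpNormLESNormFDerivOfEqInnerConst (volume : Measure (EuclideanSpace ℝ (Fin 3))) 2 : ℝ≥0) : ℝ)) ^ (3 / 2 : ℝ))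
    (s := S₀) (q := 2 * S₁ + 2 * c ^ 2 * S₀) (κ := 32 * c ^ 2) (by positivity) hS₀
    (by positivity) (by positivity) hν
  refine ⟨C, hC0, fun v φ φ' hv hφ hφc hφ0 hφ1 hcφ hφ' hφ'c hφ'0 hφ'1 hcφ' hφφ' hv0 hS₀v hv1
    hS₁v => ?_⟩
  have hφcont := hφ.continuous
  have hpφ : ∀ l x, |pderiv l φ x| ≤ c := fun l x => (abs_pderiv_le_norm_fderiv l φ x).trans (hcφ x)
  have hX0 : 0 ≤ ∫ x, φ x ^ 4 * vortSq n v x :=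
    integral_nonneg fun x => mul_nonneg (pow_nonneg (hφ0 x) 4) (vortSq_nonneg _ _ _)
  have hD0 : 0 ≤ ∫ x, φ x ^ 4 * vortSq (n + 1) v x :=
    integral_nonneg fun x => mul_nonneg (pow_nonneg (hφ0 x) 4) (vortSq_nonneg _ _ _)
  have hY0 : 0 ≤ ∫ x, φ x ^ 2 * levelSq (n + 1) v x :=
    integral_nonneg fun x => mul_nonneg (sq_nonneg _) (levelSq_nonneg _ _ _)
  -- the three fields of the trilinear bound (kept opaque, with defining equations)
  obtain ⟨f, hf⟩ : ∃ f : EuclideanSpace ℝ (Fin 3) → EuclideanSpace ℝ ((Fin n → Fin 3) × Fin 3 × Fin 3),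
      f = fun x => φ x • famVec (vortFam n v) x := ⟨_, rfl⟩
  obtain ⟨Φ₁, hΦ₁⟩ : ∃ Φ₁ : EuclideanSpace ℝ (Fin 3) → EuclideanSpace ℝ ((Fin n → Fin 3) × Fin 3 × Fin 3),
      Φ₁ = fun x => φ x ^ 2 • famVec (vortFam n v) x := ⟨_, rfl⟩
  obtain ⟨Φ₂, hΦ₂⟩ : ∃ Φ₂ : EuclideanSpace ℝ (Fin 3) → (EuclideanSpace ℝ (Fin 3)), Φ₂ = fun x => φ' x • v x := ⟨_, rfl⟩
  have hW : ContDiff ℝ ∞ (famVec (vortFam n v)) := contDiff_famVec fun c => contDiff_vortFam hv n c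
  have hfc : Continuous f := by rw [hf]; exact hφcont.smul hW.continuous
  have hfs : HasCompactSupport f := by rw [hf]; exact hφc.smul_right
  have hΦ₁d : ContDiff ℝ 1 Φ₁ := by
    rw [hΦ₁]; exact ((hφ.pow 2).smul hW).of_le (by exact_mod_cast le_top)
  have hΦ₁s : HasCompactSupport Φ₁ := by
    rw [hΦ₁]; exact (hasCompactSupport_pow hφc two_ne_zero).smul_right
  have hΦ₂d : ContDiff ℝ 1 Φ₂ := by rw [hΦ₂]; exact (hφ'.smul hv).of_le (by exact_mod_cast le_top)
  have hΦ₂s : HasCompactSupport Φ₂ := by rw [hΦ₂]; exact hφ'c.smul_right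
  -- Step 1: pointwise reduction to the trilinear integrand
  have hpt : ∀ x, 4 * φ x ^ 3 * (∑ j, pderiv j φ x * v x j) * vortSq n v x ≤
      12 * c * (‖f x‖ * (‖Φ₁ x‖ * ‖Φ₂ x‖)) := by
    intro x
    have h1 := transport_error_pointwise_le (W := fun y => Real.sqrt (vortSq n v y)) (v := v)
      hφ0 hpφ x
    have hB0 : 0 ≤ vortSq n v x := vortSq_nonneg n v x
    rw [Real.sq_sqrt hB0] at h1
    simp only [Fintype.card_fin] at h1
    push_cast at h1
    have e : ‖f x‖ * (‖Φ₁ x‖ * ‖Φ₂ x‖) = φ x ^ 3 * (‖v x‖ * vortSq n v x) := by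
      rw [hf, hΦ₁, hΦ₂]
      simp only [norm_smul, Real.norm_of_nonneg (hφ0 x), Real.norm_of_nonneg (sq_nonneg (φ x)),
        Real.norm_of_nonneg (hφ'0 x), norm_famVec_vortFam]
      by_cases hx : φ x = 0
      · simp [hx]
      · rw [hφφ' x hx]
        have := Real.mul_self_sqrt hB0
        linear_combination (φ x ^ 3 * ‖v x‖) * this
    rw [e]
    linarith
  -- Step 2: the trilinear bound
  have htri := integral_norm_mul_norm_mul_norm_le_rpow (μ := (volume : Measure (EuclideanSpace ℝ (Fin 3))))
    finrank_euclideanSpace_fin (hfc.memLp_of_hasCompactSupport hfs) hΦ₁d hΦ₁s hΦ₂d hΦ₂s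
    (K := (((eLpNormLESNormFDerivOfEqInnerConst (volume : Measure (EuclideanSpace ℝ (Fin 3))) 2 : ℝ≥0) : ℝ))) le_rfl
  -- Step 3: the six quantities
  have ef : ∫ x, ‖f x‖ ^ 2 = ∫ x, φ x ^ 2 * vortSq n v x :=
    integral_congr_ae (Eventually.of_forall fun x => by
      rw [hf]; simp only [sq_norm_smul', sq_norm_famVec_vortFam])
  have hf2 : Real.sqrt (∫ x, ‖f x‖ ^ 2) ≤ 2 * (∫ x, φ x ^ 2 * levelSq (n + 1) v x) ^ (1 / 2 : ℝ) := by
    rw [ef, ← Real.sqrt_eq_rpow]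
    calc Real.sqrt (∫ x, φ x ^ 2 * vortSq n v x)
        ≤ Real.sqrt (4 * ∫ x, φ x ^ 2 * levelSq (n + 1) v x) :=
          Real.sqrt_le_sqrt (integral_sq_mul_vortSq_le hv hφ hφc n)
      _ = 2 * Real.sqrt (∫ x, φ x ^ 2 * levelSq (n + 1) v x) := by
          rw [Real.sqrt_mul (by norm_num : (0:ℝ) ≤ 4), show (4 : ℝ) = 2 ^ 2 by norm_num,
            Real.sqrt_sq two_pos.le]
  have eP₁ : ∫ x, ‖Φ₁ x‖ ^ 2 = ∫ x, φ x ^ 4 * vortSq n v x := by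
    rw [hΦ₁]; exact integral_sq_norm_sq_smul_famVec_vortFam n
  have hP₂ : ∫ x, ‖Φ₂ x‖ ^ 2 ≤ S₀ := by
    refine le_trans ?_ hS₀v
    refine integral_mono ((hΦ₂d.continuous.norm.pow 2).integrable_of_hasCompactSupport
      (hasCompactSupport_pow hΦ₂s.norm two_ne_zero)) hv0 fun x => ?_
    rw [hΦ₂]
    simp only [sq_norm_smul']
    calc φ' x ^ 2 * ‖v x‖ ^ 2 ≤ 1 * ‖v x‖ ^ 2 :=
          mul_le_mul_of_nonneg_right (pow_le_one₀ (hφ'0 x) (hφ'1 x)) (sq_nonneg _)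
      _ = ‖v x‖ ^ 2 := one_mul _
  have hP₂0 : 0 ≤ ∫ x, ‖Φ₂ x‖ ^ 2 := integral_nonneg fun _ => sq_nonneg _
  have hQ₁ : ∫ x, ‖fderiv ℝ Φ₁ x‖ ^ 2 ≤ 2 * (∫ x, φ x ^ 4 * vortSq (n + 1) v x) +
      32 * c ^ 2 * ∫ x, φ x ^ 2 * levelSq (n + 1) v x := by
    rw [hΦ₁]
    refine (integral_sq_norm_fderiv_sq_smul_famVec_vortFam_le hv hφ hφc hφ0 hcφ n).trans ?_
    have := integral_sq_mul_vortSq_le hv hφ hφc n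
    nlinarith [sq_nonneg c]
  have hQ₁0 : 0 ≤ ∫ x, ‖fderiv ℝ Φ₁ x‖ ^ 2 := integral_nonneg fun _ => sq_nonneg _
  have hQ₂ : ∫ x, ‖fderiv ℝ Φ₂ x‖ ^ 2 ≤ 2 * S₁ + 2 * c ^ 2 * S₀ := by
    rw [hΦ₂]
    refine (integral_sq_norm_fderiv_smul_le hφ' hφ'c hcφ' (hv.of_le (by exact_mod_cast le_top))
      hv0).trans ?_
    have h1 : ∫ x, φ' x ^ 2 * ‖fderiv ℝ v x‖ ^ 2 ≤ S₁ := by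
      refine le_trans (integral_mono (integrable_pow_mul_of_continuous hφ'.continuous hφ'c
        ((hv.continuous_fderiv (by simp)).norm.pow 2) two_ne_zero) hv1 fun x => ?_) hS₁v
      calc φ' x ^ 2 * ‖fderiv ℝ v x‖ ^ 2 ≤ 1 * levelSq 1 v x :=
            mul_le_mul (pow_le_one₀ (hφ'0 x) (hφ'1 x)) (sq_norm_fderiv_le_levelSq_one hv x)
              (sq_nonneg _) zero_le_one
        _ = levelSq 1 v x := one_mul _
    nlinarith [sq_nonneg c]
  have hQ₂0 : 0 ≤ ∫ x, ‖fderiv ℝ Φ₂ x‖ ^ 2 := integral_nonneg fun _ => sq_nonneg _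
  -- Step 4: monotonicity in the six quantities
  have hq0 : 0 ≤ 2 * S₁ + 2 * c ^ 2 * S₀ := by positivity
  have hmono : (((∫ x, ‖Φ₁ x‖ ^ 2) * ∫ x, ‖Φ₂ x‖ ^ 2) ^ (1 / 8 : ℝ)) *
      (((∫ x, ‖fderiv ℝ Φ₁ x‖ ^ 2) * ∫ x, ‖fderiv ℝ Φ₂ x‖ ^ 2) ^ (3 / 8 : ℝ)) ≤
      ((∫ x, φ x ^ 4 * vortSq n v x) * S₀) ^ (1 / 8 : ℝ) *
        ((2 * (∫ x, φ x ^ 4 * vortSq (n + 1) v x) +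
            32 * c ^ 2 * ∫ x, φ x ^ 2 * levelSq (n + 1) v x) *
          (2 * S₁ + 2 * c ^ 2 * S₀)) ^ (3 / 8 : ℝ) := by
    rw [eP₁]
    refine mul_le_mul (Real.rpow_le_rpow (by positivity) (mul_le_mul_of_nonneg_left hP₂ hX0)
      (by norm_num)) (Real.rpow_le_rpow (by positivity) (mul_le_mul hQ₁ hQ₂ hQ₂0 (by positivity))
      (by norm_num)) (by positivity) (by positivity)
  -- Step 5: assemble
  have i0 : Integrable fun x => 4 * φ x ^ 3 * (∑ j, pderiv j φ x * v x j) * vortSq n v x := by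
    have : (fun x => 4 * φ x ^ 3 * (∑ j, pderiv j φ x * v x j) * vortSq n v x) =
        fun x => φ x ^ 3 * (4 * (∑ j, pderiv j φ x * v x j) * vortSq n v x) := by
      funext x; ring
    rw [this]
    refine integrable_pow_mul_of_continuous hφcont hφc ?_ (by norm_num)
    refine (continuous_const.mul (continuous_finsetSum _ fun j _ => ?_)).mul
      (continuous_vortSq hv n)
    exact (continuous_pderiv hφ (by simp) j).mul ((contDiff_comp_of_contDiff hv j).continuous)
  have hsupp : HasCompactSupport fun x => ‖f x‖ * (‖Φ₁ x‖ * ‖Φ₂ x‖) := hfs.norm.mul_right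
  have hcont3 : Continuous fun x => ‖f x‖ * (‖Φ₁ x‖ * ‖Φ₂ x‖) :=
    hfc.norm.mul (hΦ₁d.continuous.norm.mul hΦ₂d.continuous.norm)
  have i1 : Integrable fun x => 12 * c * (‖f x‖ * (‖Φ₁ x‖ * ‖Φ₂ x‖)) :=
    (hcont3.integrable_of_hasCompactSupport hsupp).const_mul _
  have hamgm := rpow_amgm₃ (a := ∫ x, φ x ^ 2 * levelSq (n + 1) v x)
    (b := (∫ x, φ x ^ 4 * vortSq n v x) * S₀)
    (c := (2 * (∫ x, φ x ^ 4 * vortSq (n + 1) v x) +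
            32 * c ^ 2 * ∫ x, φ x ^ 2 * levelSq (n + 1) v x) * (2 * S₁ + 2 * c ^ 2 * S₀))
    hY0 (by positivity) (by positivity) hε
  have hfin := hC _ _ _ hX0 hY0 hD0
  calc ∫ x, 4 * φ x ^ 3 * (∑ j, pderiv j φ x * v x j) * vortSq n v x
      ≤ ∫ x, 12 * c * (‖f x‖ * (‖Φ₁ x‖ * ‖Φ₂ x‖)) := integral_mono i0 i1 hpt
    _ = 12 * c * ∫ x, ‖f x‖ * (‖Φ₁ x‖ * ‖Φ₂ x‖) := integral_const_mul _ _
    _ ≤ 12 * c * (2 * (∫ x, φ x ^ 2 * levelSq (n + 1) v x) ^ (1 / 2 : ℝ) * ((((eLpNormLESNormFDerivOfEqInnerConst (volume : Measure (EuclideanSpace ℝ (Fin 3))) 2 : ℝ≥0) : ℝ)) ^ (3 / 2 : ℝ) *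
          (((∫ x, φ x ^ 4 * vortSq n v x) * S₀) ^ (1 / 8 : ℝ) *
            ((2 * (∫ x, φ x ^ 4 * vortSq (n + 1) v x) +
                32 * c ^ 2 * ∫ x, φ x ^ 2 * levelSq (n + 1) v x) *
              (2 * S₁ + 2 * c ^ 2 * S₀)) ^ (3 / 8 : ℝ)))) := by
        refine mul_le_mul_of_nonneg_left (htri.trans ?_) (by positivity)
        exact mul_le_mul hf2 (mul_le_mul_of_nonneg_left hmono (by positivity)) (by positivity)
          (by positivity)
    _ = 24 * c * (((eLpNormLESNormFDerivOfEqInnerConst (volume : Measure (EuclideanSpace ℝ (Fin 3))) 2 : ℝ≥0) : ℝ)) ^ (3 / 2 : ℝ) * ((∫ x, φ x ^ 2 * levelSq (n + 1) v x) ^ (1 / 2 : ℝ) *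
          ((∫ x, φ x ^ 4 * vortSq n v x) * S₀) ^ (1 / 8 : ℝ) *
          ((2 * (∫ x, φ x ^ 4 * vortSq (n + 1) v x) +
              32 * c ^ 2 * ∫ x, φ x ^ 2 * levelSq (n + 1) v x) *
            (2 * S₁ + 2 * c ^ 2 * S₀)) ^ (3 / 8 : ℝ)) := by ring
    _ ≤ 24 * c * (((eLpNormLESNormFDerivOfEqInnerConst (volume : Measure (EuclideanSpace ℝ (Fin 3))) 2 : ℝ≥0) : ℝ)) ^ (3 / 2 : ℝ) * (1 / 2 * (∫ x, φ x ^ 2 * levelSq (n + 1) v x) +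
          1 / 8 * (ε⁻¹ ^ 3 * ((∫ x, φ x ^ 4 * vortSq n v x) * S₀)) +
          3 / 8 * (ε * ((2 * (∫ x, φ x ^ 4 * vortSq (n + 1) v x) +
              32 * c ^ 2 * ∫ x, φ x ^ 2 * levelSq (n + 1) v x) * (2 * S₁ + 2 * c ^ 2 * S₀)))) :=
        mul_le_mul_of_nonneg_left hamgm (by positivity)
    _ ≤ _ := hfin

/-- A component of a bundled family is bounded by the bundle's norm. [folklore] -/
theorem abs_famVec_apply_le {κ : Type*} [Fintype κ] (g : κ → EuclideanSpace ℝ (Fin 3) → ℝ) (x : EuclideanSpace ℝ (Fin 3)) (c : κ) :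
    |g c x| ≤ ‖famVec g x‖ := by
  have h := PiLp.norm_apply_le (p := 2) (famVec g x) c
  simpa [Real.norm_eq_abs] using h

/-- **Reduction of the forcing terms** to trilinear integrals: if `|F_c| ≤ C_F G` pointwise with
`G = ∑_{a=1}^{n+1} |∇ᵃv| |∇^{n+2-a}v|`, `C_F ≥ 0` and `n ≥ 1`, then
`∑_c 2 ∫ φ⁴ (∂^βΩ_{ki}) F_c ≤ 4 · #c · C_F ∑_{a=1}^{n} ∫ φ⁴ |∇ᵃv| |∇^{n+2-a}v| |∇ⁿΩ|`
(`|∂^βΩ_{ki}| ≤ |∇ⁿΩ|` and the symmetrisation `a ↔ n + 2 - a`). [folklore] -/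
theorem forcing_reduction {CF : ℝ} (hCF : 0 ≤ CF) {n : ℕ} (hn : 1 ≤ n) (hv : ContDiff ℝ ∞ v)
    (hφ : ContDiff ℝ ∞ φ) (hφc : HasCompactSupport φ) (hφ0 : ∀ x, 0 ≤ φ x)
    {F : (Fin n → Fin 3) × Fin 3 × Fin 3 → EuclideanSpace ℝ (Fin 3) → ℝ} (hFc : ∀ c', Continuous (F c'))
    (hF : ∀ c' x, |F c' x| ≤ CF * ∑ a ∈ Finset.Icc 1 (n + 1),
      Real.sqrt (levelSq a v x) * Real.sqrt (levelSq (n + 2 - a) v x)) :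
    ∑ c', 2 * ∫ x, φ x ^ 4 * (vortFam n v c' x * F c' x) ≤
      4 * Fintype.card ((Fin n → Fin 3) × Fin 3 × Fin 3) * CF *
        ∑ a ∈ Finset.Icc 1 n, ∫ x, φ x ^ 4 *
          (Real.sqrt (levelSq a v x) * Real.sqrt (levelSq (n + 2 - a) v x) *
            Real.sqrt (vortSq n v x)) := by
  have hφcont := hφ.continuous
  obtain ⟨G, hG⟩ : ∃ G : EuclideanSpace ℝ (Fin 3) → ℝ, G = fun x => ∑ a ∈ Finset.Icc 1 (n + 1),
    Real.sqrt (levelSq a v x) * Real.sqrt (levelSq (n + 2 - a) v x) := ⟨_, rfl⟩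
  obtain ⟨G', hG'⟩ : ∃ G' : EuclideanSpace ℝ (Fin 3) → ℝ, G' = fun x => ∑ a ∈ Finset.Icc 1 n,
    Real.sqrt (levelSq a v x) * Real.sqrt (levelSq (n + 2 - a) v x) := ⟨_, rfl⟩
  have csq : ∀ a, Continuous fun x => Real.sqrt (levelSq a v x) := fun a =>
    (continuous_levelSq hv a).sqrt
  have cT : ∀ a b : ℕ, Continuous fun x => Real.sqrt (levelSq a v x) * Real.sqrt (levelSq b v x) :=
    fun a b => (csq a).mul (csq b)
  have cG : Continuous G := by
    rw [hG]
    exact continuous_finsetSum _ fun a _ => cT a _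
  have cB : Continuous fun x => Real.sqrt (vortSq n v x) := (continuous_vortSq hv n).sqrt
  have iT : ∀ a : ℕ, Integrable fun x => φ x ^ 4 *
      (Real.sqrt (levelSq a v x) * Real.sqrt (levelSq (n + 2 - a) v x) * Real.sqrt (vortSq n v x)) :=
    fun a => integrable_pow_mul_of_continuous hφcont hφc ((cT a _).mul cB) (by norm_num)
  have hGG' : ∀ x, G x ≤ 2 * G' x := fun x => by
    rw [hG, hG']
    exact sum_Icc_succ_mul_le_two_mul (ℓ := fun a => Real.sqrt (levelSq a v x))
      (fun a => Real.sqrt_nonneg _) hn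
  -- each `c`
  have hstep1 : ∀ c', 2 * ∫ x, φ x ^ 4 * (vortFam n v c' x * F c' x) ≤
      2 * CF * ∫ x, φ x ^ 4 * (Real.sqrt (vortSq n v x) * G x) := by
    intro c'
    rw [mul_assoc, ← integral_const_mul CF]
    refine mul_le_mul_of_nonneg_left (integral_mono ?_ ?_ fun x => ?_) two_pos.le
    · exact integrable_pow_mul_of_continuous hφcont hφc
        ((contDiff_vortFam hv n c').continuous.mul (hFc c')) (by norm_num)
    · exact (integrable_pow_mul_of_continuous hφcont hφc (cB.mul cG) (by norm_num)).const_mul _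
    · have h1 : vortFam n v c' x * F c' x ≤ Real.sqrt (vortSq n v x) * (CF * G x) := by
        refine (le_abs_self _).trans ?_
        rw [abs_mul, hG]
        refine mul_le_mul ((abs_famVec_apply_le _ x c').trans (le_of_eq (norm_famVec_vortFam n v x)))
          (hF c' x) (abs_nonneg _) (Real.sqrt_nonneg _)
      have h4 : 0 ≤ φ x ^ 4 := pow_nonneg (hφ0 x) 4
      nlinarith
  -- symmetrisation
  have hstep2 : ∫ x, φ x ^ 4 * (Real.sqrt (vortSq n v x) * G x) ≤
      2 * ∑ a ∈ Finset.Icc 1 n, ∫ x, φ x ^ 4 *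
        (Real.sqrt (levelSq a v x) * Real.sqrt (levelSq (n + 2 - a) v x) *
          Real.sqrt (vortSq n v x)) := by
    rw [← integral_finsetSum _ fun a _ => iT a, ← integral_const_mul]
    refine integral_mono (integrable_pow_mul_of_continuous hφcont hφc (cB.mul cG) (by norm_num))
      ((integrable_finsetSum _ fun a _ => iT a).const_mul _) fun x => ?_
    have h4 : 0 ≤ φ x ^ 4 := pow_nonneg (hφ0 x) 4
    have hB := Real.sqrt_nonneg (vortSq n v x)
    have := hGG' x
    calc φ x ^ 4 * (Real.sqrt (vortSq n v x) * G x)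
        ≤ φ x ^ 4 * (Real.sqrt (vortSq n v x) * (2 * G' x)) :=
          mul_le_mul_of_nonneg_left (mul_le_mul_of_nonneg_left this hB) h4
      _ = 2 * ∑ a ∈ Finset.Icc 1 n, φ x ^ 4 *
            (Real.sqrt (levelSq a v x) * Real.sqrt (levelSq (n + 2 - a) v x) *
              Real.sqrt (vortSq n v x)) := by
          rw [hG']
          simp only [Finset.mul_sum]
          exact Finset.sum_congr rfl fun a _ => by ring
  have hI0 : 0 ≤ ∫ x, φ x ^ 4 * (Real.sqrt (vortSq n v x) * G x) :=
    integral_nonneg fun x => mul_nonneg (pow_nonneg (hφ0 x) 4) (mul_nonneg (Real.sqrt_nonneg _)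
      (by rw [hG]; exact Finset.sum_nonneg fun a _ =>
        mul_nonneg (Real.sqrt_nonneg _) (Real.sqrt_nonneg _)))
  calc ∑ c', 2 * ∫ x, φ x ^ 4 * (vortFam n v c' x * F c' x)
      ≤ ∑ _c' : (Fin n → Fin 3) × Fin 3 × Fin 3,
          2 * CF * ∫ x, φ x ^ 4 * (Real.sqrt (vortSq n v x) * G x) :=
        Finset.sum_le_sum fun c' _ => hstep1 c'
    _ = Fintype.card ((Fin n → Fin 3) × Fin 3 × Fin 3) *
          (2 * CF * ∫ x, φ x ^ 4 * (Real.sqrt (vortSq n v x) * G x)) := by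
        rw [Finset.sum_const, Finset.card_univ, nsmul_eq_mul]
    _ ≤ Fintype.card ((Fin n → Fin 3) × Fin 3 × Fin 3) * (2 * CF *
          (2 * ∑ a ∈ Finset.Icc 1 n, ∫ x, φ x ^ 4 *
            (Real.sqrt (levelSq a v x) * Real.sqrt (levelSq (n + 2 - a) v x) *
              Real.sqrt (vortSq n v x)))) :=
        mul_le_mul_of_nonneg_left (mul_le_mul_of_nonneg_left hstep2 (by positivity))
          (Nat.cast_nonneg _)
    _ = _ := by ring

/-- **One trilinear forcing piece.** For smooth `v`, a smooth compactly supported `0 ≤ φ` with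
`‖Dφ‖ ≤ c`, `∇ᵃv ∈ L²` and `ε > 0`:
`∫ φ⁴ |∇ᵃv| |∇ᵇv| |∇ⁿΩ| ≤ ‖∇ᵃv‖₂ K^{3/2} (⅛ ε⁻³ (∫ φ⁴|∇ᵇv|² + ∫ φ⁴|∇ⁿΩ|²)
  + ⅜ ε ((2∫ φ⁴|∇^{b+1}v|² + 8c² ∫ φ²|∇ᵇv|²) + (2∫ φ⁴|∇^{n+1}Ω|² + 8c² ∫ φ²|∇ⁿΩ|²)))`
(the trilinear Gagliardo–Nirenberg–Sobolev bound with `f = ∇ᵃv`, `Φ₁ = φ²∇ᵇv`, `Φ₂ = φ²∇ⁿΩ`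
bundled as Euclidean-space-valued maps, and the weighted derivative bounds). [folklore] -/
theorem forcing_trilinear_piece (hv : ContDiff ℝ ∞ v) (hφ : ContDiff ℝ ∞ φ)
    (hφc : HasCompactSupport φ) (hφ0 : ∀ x, 0 ≤ φ x) {c : ℝ} (hcφ : ∀ x, ‖fderiv ℝ φ x‖ ≤ c)
    {ε : ℝ} (hε : 0 < ε) (a b n : ℕ) (hfa : Integrable (levelSq a v)) :
    ∫ x, φ x ^ 4 * (Real.sqrt (levelSq a v x) * Real.sqrt (levelSq b v x) *
        Real.sqrt (vortSq n v x)) ≤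
      Real.sqrt (∫ x, levelSq a v x) * (((eLpNormLESNormFDerivOfEqInnerConst (volume : Measure (EuclideanSpace ℝ (Fin 3))) 2 : ℝ≥0) : ℝ)) ^ (3 / 2 : ℝ) *
        (1 / 8 * (ε⁻¹ ^ 3 * ((∫ x, φ x ^ 4 * levelSq b v x) + ∫ x, φ x ^ 4 * vortSq n v x)) +
          3 / 8 * (ε * ((2 * (∫ x, φ x ^ 4 * levelSq (b + 1) v x) +
              8 * c ^ 2 * ∫ x, φ x ^ 2 * levelSq b v x) +
            (2 * (∫ x, φ x ^ 4 * vortSq (n + 1) v x) +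
              8 * c ^ 2 * ∫ x, φ x ^ 2 * vortSq n v x)))) := by
  have hK0 : 0 ≤ (((eLpNormLESNormFDerivOfEqInnerConst (volume : Measure (EuclideanSpace ℝ (Fin 3))) 2 : ℝ≥0) : ℝ)) := NNReal.coe_nonneg _
  have hWc : ContDiff ℝ ∞ (famVec (vortFam n v)) := contDiff_famVec fun c => contDiff_vortFam hv n c
  have hLc : ∀ m, ContDiff ℝ ∞ (famVec (levelFam m v)) := fun m =>
    contDiff_famVec fun c => contDiff_levelFam hv m c
  obtain ⟨f, hf⟩ : ∃ f : EuclideanSpace ℝ (Fin 3) → EuclideanSpace ℝ ((Fin a → Fin 3) × Fin 3),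
      f = famVec (levelFam a v) := ⟨_, rfl⟩
  obtain ⟨Φ₁, hΦ₁⟩ : ∃ Φ₁ : EuclideanSpace ℝ (Fin 3) → EuclideanSpace ℝ ((Fin b → Fin 3) × Fin 3),
      Φ₁ = fun x => φ x ^ 2 • famVec (levelFam b v) x := ⟨_, rfl⟩
  obtain ⟨Φ₂, hΦ₂⟩ : ∃ Φ₂ : EuclideanSpace ℝ (Fin 3) → EuclideanSpace ℝ ((Fin n → Fin 3) × Fin 3 × Fin 3),
      Φ₂ = fun x => φ x ^ 2 • famVec (vortFam n v) x := ⟨_, rfl⟩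
  have hfc : Continuous f := by rw [hf]; exact (hLc a).continuous
  have hfm : MemLp f 2 (volume : Measure (EuclideanSpace ℝ (Fin 3))) := by
    refine (memLp_two_iff_integrable_sq_norm hfc.aestronglyMeasurable).2 ?_
    refine hfa.congr (Eventually.of_forall fun x => ?_)
    simp only [hf, sq_norm_famVec_levelFam]
  have hΦ₁d : ContDiff ℝ 1 Φ₁ := by
    rw [hΦ₁]; exact ((hφ.pow 2).smul (hLc b)).of_le (by exact_mod_cast le_top)
  have hΦ₁s : HasCompactSupport Φ₁ := by
    rw [hΦ₁]; exact (hasCompactSupport_pow hφc two_ne_zero).smul_right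
  have hΦ₂d : ContDiff ℝ 1 Φ₂ := by
    rw [hΦ₂]; exact ((hφ.pow 2).smul hWc).of_le (by exact_mod_cast le_top)
  have hΦ₂s : HasCompactSupport Φ₂ := by
    rw [hΦ₂]; exact (hasCompactSupport_pow hφc two_ne_zero).smul_right
  have e : ∀ x, φ x ^ 4 * (Real.sqrt (levelSq a v x) * Real.sqrt (levelSq b v x) *
      Real.sqrt (vortSq n v x)) = ‖f x‖ * (‖Φ₁ x‖ * ‖Φ₂ x‖) := by
    intro x
    rw [hf, hΦ₁, hΦ₂]
    simp only [norm_smul, Real.norm_of_nonneg (sq_nonneg (φ x)), norm_famVec_vortFam,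
      norm_famVec_levelFam]
    ring
  have htri := integral_norm_mul_norm_mul_norm_le (μ := (volume : Measure (EuclideanSpace ℝ (Fin 3))))
    finrank_euclideanSpace_fin hfm hΦ₁d hΦ₁s hΦ₂d hΦ₂s (K := (((eLpNormLESNormFDerivOfEqInnerConst (volume : Measure (EuclideanSpace ℝ (Fin 3))) 2 : ℝ≥0) : ℝ))) le_rfl hε
  have ef : ∫ x, ‖f x‖ ^ 2 = ∫ x, levelSq a v x :=
    integral_congr_ae (Eventually.of_forall fun x => by simp only [hf, sq_norm_famVec_levelFam])
  have eP₁ : ∫ x, ‖Φ₁ x‖ ^ 2 = ∫ x, φ x ^ 4 * levelSq b v x := by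
    rw [hΦ₁]; exact integral_sq_norm_sq_smul_famVec_levelFam b
  have eP₂ : ∫ x, ‖Φ₂ x‖ ^ 2 = ∫ x, φ x ^ 4 * vortSq n v x := by
    rw [hΦ₂]; exact integral_sq_norm_sq_smul_famVec_vortFam n
  have hQ₁ : ∫ x, ‖fderiv ℝ Φ₁ x‖ ^ 2 ≤ 2 * (∫ x, φ x ^ 4 * levelSq (b + 1) v x) +
      8 * c ^ 2 * ∫ x, φ x ^ 2 * levelSq b v x := by
    rw [hΦ₁]; exact integral_sq_norm_fderiv_sq_smul_famVec_levelFam_le hv hφ hφc hφ0 hcφ b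
  have hQ₂ : ∫ x, ‖fderiv ℝ Φ₂ x‖ ^ 2 ≤ 2 * (∫ x, φ x ^ 4 * vortSq (n + 1) v x) +
      8 * c ^ 2 * ∫ x, φ x ^ 2 * vortSq n v x := by
    rw [hΦ₂]; exact integral_sq_norm_fderiv_sq_smul_famVec_vortFam_le hv hφ hφc hφ0 hcφ n
  rw [integral_congr_ae (Eventually.of_forall e)]
  refine htri.trans ?_
  rw [ef, eP₁, eP₂]
  have hi : 0 ≤ ε⁻¹ ^ 3 := by positivity
  refine mul_le_mul_of_nonneg_left (add_le_add le_rfl ?_) (by positivity)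
  exact mul_le_mul_of_nonneg_left (mul_le_mul_of_nonneg_left (add_le_add hQ₁ hQ₂) hε.le)
    (by norm_num)

/-- **The forcing terms.** Given `ν > 0`, the gradient bound `c`, the constant `C_F ≥ 0` of the
pointwise forcing bound, `n ≥ 1` and global bounds `S m ≥ ∫ |∇ᵐ v|²` (`m ≤ n`), there is `C` such
that for every smooth divergence-free `v` obeying these bounds, every smooth compactly supported
`0 ≤ φ ≤ 1` with `‖Dφ‖ ≤ c` and every continuous family `F` with
`|F_{βki}| ≤ C_F ∑_{a=1}^{n+1} |∇ᵃv| |∇^{n+2-a}v|`,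
`∑ 2 ∫ φ⁴ (∂^βΩ_{ki}) F_{βki} ≤ (ν/4) ∫ φ⁴ |∇^{n+1}Ω|² + C (1 + ∫ φ⁴ |∇ⁿΩ|² + ∫ φ² |∇^{n+1}v|²)`
(reduction to trilinear pieces, the pieces bounded by `forcing_trilinear_piece`, the weighted
div–curl inequality for the top-order term, and the absorption `exists_eps_absorb_four`). [folklore] -/
theorem forcing_term_le {ν c CF : ℝ} (hν : 0 < ν) (hCF : 0 ≤ CF) {n : ℕ}
    (hn : 1 ≤ n) (S : ℕ → ℝ) (hS : ∀ m, 0 ≤ S m) :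
    ∃ C : ℝ, 0 ≤ C ∧ ∀ (v : EuclideanSpace ℝ (Fin 3) → EuclideanSpace ℝ (Fin 3)) (φ : EuclideanSpace ℝ (Fin 3) → ℝ)
      (F : (Fin n → Fin 3) × Fin 3 × Fin 3 → EuclideanSpace ℝ (Fin 3) → ℝ),
      ContDiff ℝ ∞ v → (∀ x, ∑ i, pderiv i (fun y => v y i) x = 0) →
      ContDiff ℝ ∞ φ → HasCompactSupport φ → (∀ x, 0 ≤ φ x) → (∀ x, φ x ≤ 1) →
      (∀ x, ‖fderiv ℝ φ x‖ ≤ c) → (∀ c', Continuous (F c')) →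
      (∀ c' x, |F c' x| ≤ CF * ∑ a ∈ Finset.Icc 1 (n + 1),
          Real.sqrt (levelSq a v x) * Real.sqrt (levelSq (n + 2 - a) v x)) →
      (∀ m ≤ n, Integrable (levelSq m v)) → (∀ m ≤ n, ∫ x, levelSq m v x ≤ S m) →
      ∑ c', 2 * ∫ x, φ x ^ 4 * (vortFam n v c' x * F c' x) ≤
        ν / 4 * (∫ x, φ x ^ 4 * vortSq (n + 1) v x) +
          C * (1 + (∫ x, φ x ^ 4 * vortSq n v x) + ∫ x, φ x ^ 2 * levelSq (n + 1) v x) := by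
  have hK0 : 0 ≤ (((eLpNormLESNormFDerivOfEqInnerConst (volume : Measure (EuclideanSpace ℝ (Fin 3))) 2 : ℝ≥0) : ℝ)) := NNReal.coe_nonneg _
  -- the uniform constant `Ŝ = ∑_{m ≤ n} S m` and the number of vorticity components
  obtain ⟨SS, hSS⟩ : ∃ SS : ℝ, SS = ∑ m ∈ Finset.range (n + 1), S m := ⟨_, rfl⟩
  have hSS0 : 0 ≤ SS := hSS ▸ Finset.sum_nonneg fun m _ => hS m
  have hSle : ∀ m ≤ n, S m ≤ SS := fun m hm => hSS ▸
    Finset.single_le_sum (f := S) (fun m _ => hS m) (Finset.mem_range.2 (Nat.lt_succ_of_le hm))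
  obtain ⟨card, hcard⟩ : ∃ card : ℝ, card = (Fintype.card ((Fin n → Fin 3) × Fin 3 × Fin 3) : ℝ) :=
    ⟨_, rfl⟩
  have hcard0 : 0 ≤ card := hcard ▸ Nat.cast_nonneg _
  obtain ⟨ε, hε, C, hC0, hC⟩ := exists_eps_absorb_four
    (A := n * (4 * card * CF * (Real.sqrt SS * (((eLpNormLESNormFDerivOfEqInnerConst (volume : Measure (EuclideanSpace ℝ (Fin 3))) 2 : ℝ≥0) : ℝ)) ^ (3 / 2 : ℝ)))) (p := SS)
    (q₀ := (2 + 8 * c ^ 2) * SS) (q₁ := 2 + 136 * c ^ 2) (by positivity) hSS0 (by positivity)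
    (by positivity) hν
  refine ⟨C, hC0, fun v φ F hv hdiv hφ hφc hφ0 hφ1 hcφ hFc hF hint hSv => ?_⟩
  have hpφ : ∀ l x, |pderiv l φ x| ≤ c := fun l x => (abs_pderiv_le_norm_fderiv l φ x).trans (hcφ x)
  have hX0 : 0 ≤ ∫ x, φ x ^ 4 * vortSq n v x :=
    integral_nonneg fun x => mul_nonneg (pow_nonneg (hφ0 x) 4) (vortSq_nonneg _ _ _)
  have hD0 : 0 ≤ ∫ x, φ x ^ 4 * vortSq (n + 1) v x :=
    integral_nonneg fun x => mul_nonneg (pow_nonneg (hφ0 x) 4) (vortSq_nonneg _ _ _)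
  have hY0 : 0 ≤ ∫ x, φ x ^ 2 * levelSq (n + 1) v x :=
    integral_nonneg fun x => mul_nonneg (sq_nonneg _) (levelSq_nonneg _ _ _)
  -- uniform bounds for the weighted level integrals
  have hA2 : ∀ b ≤ n + 1, ∫ x, φ x ^ 2 * levelSq b v x ≤ SS + ∫ x, φ x ^ 2 * levelSq (n + 1) v x := by
    intro b hb
    rcases Nat.lt_or_ge b (n + 1) with hb' | hb'
    · have hbn : b ≤ n := Nat.lt_succ_iff.1 hb'
      calc ∫ x, φ x ^ 2 * levelSq b v x ≤ ∫ x, levelSq b v x :=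
            integral_pow_mul_le_integral (continuous_levelSq hv b) (levelSq_nonneg b v) (hint b hbn)
              hφ hφc hφ0 hφ1 two_ne_zero
        _ ≤ SS + ∫ x, φ x ^ 2 * levelSq (n + 1) v x := by linarith [hSv b hbn, hSle b hbn]
    · have : b = n + 1 := le_antisymm hb hb'
      subst this
      linarith
  have hA4 : ∀ b ≤ n + 1, ∫ x, φ x ^ 4 * levelSq b v x ≤ SS + ∫ x, φ x ^ 2 * levelSq (n + 1) v x :=
    fun b hb => (integral_pow_four_mul_le_integral_sq_mul (continuous_levelSq hv b)
      (levelSq_nonneg b v) hφ hφc hφ0 hφ1).trans (hA2 b hb)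
  have hWDC := integral_pow_four_mul_levelSq_succ_le hv hdiv hφ hφc hφ0 hpφ (n + 1)
  simp only [Fintype.card_fin] at hWDC
  push_cast at hWDC
  have hA4' : ∀ b ≤ n + 2, ∫ x, φ x ^ 4 * levelSq b v x ≤
      SS + (∫ x, φ x ^ 2 * levelSq (n + 1) v x) + ((∫ x, φ x ^ 4 * vortSq (n + 1) v x) +
        48 * c ^ 2 * ∫ x, φ x ^ 2 * levelSq (n + 1) v x) := by
    intro b hb
    rcases Nat.lt_or_ge b (n + 2) with hb' | hb'
    · have := hA4 b (Nat.lt_succ_iff.1 hb')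
      nlinarith [hD0, hY0, sq_nonneg c]
    · have : b = n + 1 + 1 := by omega
      subst this
      nlinarith [hWDC, hSS0, hY0]
  have hB2 : ∫ x, φ x ^ 2 * vortSq n v x ≤ 4 * ∫ x, φ x ^ 2 * levelSq (n + 1) v x :=
    integral_sq_mul_vortSq_le hv hφ hφc n
  -- each trilinear piece, uniformly
  have hpiece : ∀ a ∈ Finset.Icc 1 n, ∫ x, φ x ^ 4 *
      (Real.sqrt (levelSq a v x) * Real.sqrt (levelSq (n + 2 - a) v x) * Real.sqrt (vortSq n v x)) ≤
      Real.sqrt SS * (((eLpNormLESNormFDerivOfEqInnerConst (volume : Measure (EuclideanSpace ℝ (Fin 3))) 2 : ℝ≥0) : ℝ)) ^ (3 / 2 : ℝ) *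
        (1 / 8 * (ε⁻¹ ^ 3 * (SS + (∫ x, φ x ^ 2 * levelSq (n + 1) v x) +
            ∫ x, φ x ^ 4 * vortSq n v x)) +
          3 / 8 * (ε * (4 * (∫ x, φ x ^ 4 * vortSq (n + 1) v x) +
            (2 + 136 * c ^ 2) * (∫ x, φ x ^ 2 * levelSq (n + 1) v x) + (2 + 8 * c ^ 2) * SS))) := by
    intro a ha
    rw [Finset.mem_Icc] at ha
    have hb1 : n + 2 - a ≤ n + 1 := by omega
    have hb2 : n + 2 - a + 1 ≤ n + 2 := by omega
    refine (forcing_trilinear_piece hv hφ hφc hφ0 hcφ hε a (n + 2 - a) n (hint a ha.2)).trans ?_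
    have hf2 : Real.sqrt (∫ x, levelSq a v x) ≤ Real.sqrt SS :=
      Real.sqrt_le_sqrt ((hSv a ha.2).trans (hSle a ha.2))
    have hP : (∫ x, φ x ^ 4 * levelSq (n + 2 - a) v x) + ∫ x, φ x ^ 4 * vortSq n v x ≤
        SS + (∫ x, φ x ^ 2 * levelSq (n + 1) v x) + ∫ x, φ x ^ 4 * vortSq n v x := by
      linarith [hA4 _ hb1]
    have hQ : (2 * (∫ x, φ x ^ 4 * levelSq (n + 2 - a + 1) v x) +
          8 * c ^ 2 * ∫ x, φ x ^ 2 * levelSq (n + 2 - a) v x) +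
        (2 * (∫ x, φ x ^ 4 * vortSq (n + 1) v x) + 8 * c ^ 2 * ∫ x, φ x ^ 2 * vortSq n v x) ≤
        4 * (∫ x, φ x ^ 4 * vortSq (n + 1) v x) +
          (2 + 136 * c ^ 2) * (∫ x, φ x ^ 2 * levelSq (n + 1) v x) + (2 + 8 * c ^ 2) * SS := by
      have h1 := hA4' _ hb2
      have h2 := hA2 _ hb1
      nlinarith [hB2, sq_nonneg c, hY0, hSS0]
    have hP0 : 0 ≤ (∫ x, φ x ^ 4 * levelSq (n + 2 - a) v x) + ∫ x, φ x ^ 4 * vortSq n v x :=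
      add_nonneg (integral_nonneg fun x => mul_nonneg (pow_nonneg (hφ0 x) 4) (levelSq_nonneg _ _ _))
        hX0
    have hQ0 : 0 ≤ (2 * (∫ x, φ x ^ 4 * levelSq (n + 2 - a + 1) v x) +
          8 * c ^ 2 * ∫ x, φ x ^ 2 * levelSq (n + 2 - a) v x) +
        (2 * (∫ x, φ x ^ 4 * vortSq (n + 1) v x) + 8 * c ^ 2 * ∫ x, φ x ^ 2 * vortSq n v x) := by
      have i1 : 0 ≤ ∫ x, φ x ^ 4 * levelSq (n + 2 - a + 1) v x :=
        integral_nonneg fun x => mul_nonneg (pow_nonneg (hφ0 x) 4) (levelSq_nonneg _ _ _)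
      have i2 : 0 ≤ ∫ x, φ x ^ 2 * levelSq (n + 2 - a) v x :=
        integral_nonneg fun x => mul_nonneg (sq_nonneg _) (levelSq_nonneg _ _ _)
      have i3 : 0 ≤ ∫ x, φ x ^ 2 * vortSq n v x :=
        integral_nonneg fun x => mul_nonneg (sq_nonneg _) (vortSq_nonneg _ _ _)
      positivity
    have hi : 0 ≤ ε⁻¹ ^ 3 := by positivity
    have hbr0 : 0 ≤ 1 / 8 * (ε⁻¹ ^ 3 * ((∫ x, φ x ^ 4 * levelSq (n + 2 - a) v x) +
        ∫ x, φ x ^ 4 * vortSq n v x)) + 3 / 8 * (ε *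
        ((2 * (∫ x, φ x ^ 4 * levelSq (n + 2 - a + 1) v x) +
            8 * c ^ 2 * ∫ x, φ x ^ 2 * levelSq (n + 2 - a) v x) +
          (2 * (∫ x, φ x ^ 4 * vortSq (n + 1) v x) + 8 * c ^ 2 * ∫ x, φ x ^ 2 * vortSq n v x))) := by
      positivity
    refine le_trans (mul_le_mul_of_nonneg_right (mul_le_mul_of_nonneg_right hf2 (by positivity))
      hbr0) ?_
    refine mul_le_mul_of_nonneg_left (add_le_add ?_ ?_) (by positivity)
    · exact mul_le_mul_of_nonneg_left (mul_le_mul_of_nonneg_left hP hi) (by norm_num)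
    · exact mul_le_mul_of_nonneg_left (mul_le_mul_of_nonneg_left hQ hε.le) (by norm_num)
  -- assemble
  have hsum := Finset.sum_le_sum hpiece
  rw [Finset.sum_const, Nat.card_Icc, Nat.add_sub_cancel, nsmul_eq_mul] at hsum
  have hred := forcing_reduction hCF hn hv hφ hφc hφ0 hFc hF
  rw [← hcard] at hred
  have hfin := hC _ _ _ hX0 hY0 hD0
  refine hred.trans (le_trans ?_ hfin)
  calc 4 * card * CF * ∑ a ∈ Finset.Icc 1 n, ∫ x, φ x ^ 4 *
          (Real.sqrt (levelSq a v x) * Real.sqrt (levelSq (n + 2 - a) v x) *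
            Real.sqrt (vortSq n v x))
      ≤ 4 * card * CF * (n * (Real.sqrt SS * (((eLpNormLESNormFDerivOfEqInnerConst (volume : Measure (EuclideanSpace ℝ (Fin 3))) 2 : ℝ≥0) : ℝ)) ^ (3 / 2 : ℝ) *
        (1 / 8 * (ε⁻¹ ^ 3 * (SS + (∫ x, φ x ^ 2 * levelSq (n + 1) v x) +
            ∫ x, φ x ^ 4 * vortSq n v x)) +
          3 / 8 * (ε * (4 * (∫ x, φ x ^ 4 * vortSq (n + 1) v x) +
            (2 + 136 * c ^ 2) * (∫ x, φ x ^ 2 * levelSq (n + 1) v x) +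
              (2 + 8 * c ^ 2) * SS))))) :=
        mul_le_mul_of_nonneg_left hsum (by positivity)
    _ = _ := by ring

/-- **One vorticity component.** For smooth `W`, a smooth divergence-free `v`, a continuous `Ẇ`
(the time derivative) and the forcing `F := Ẇ − ν ΔW + v·∇W`:
`2 ∫ φ⁴ Ẇ W ≤ ν (−(3/2) ∫ φ⁴ |∇W|² + 96 c² ∫ φ² W²) + ∫ 4φ³ (∇φ·v) W² + 2 ∫ φ⁴ W F`
(the viscous pairing, the transport pairing, and the definition of `F`). [folklore] -/
theorem component_pairing_le {W Wdot : EuclideanSpace ℝ (Fin 3) → ℝ} (hW : ContDiff ℝ ∞ W) (hWdot : Continuous Wdot)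
    (hv : ContDiff ℝ ∞ v) (hdiv : ∀ x, ∑ j, pderiv j (fun y => v y j) x = 0)
    (hφ : ContDiff ℝ ∞ φ) (hφc : HasCompactSupport φ) (hφ0 : ∀ x, 0 ≤ φ x) {c : ℝ}
    (hc : ∀ l x, |pderiv l φ x| ≤ c) {ν : ℝ} (hν : 0 ≤ ν) :
    2 * ∫ x, φ x ^ 4 * (Wdot x * W x) ≤
      ν * (-(3 / 2) * (∫ x, φ x ^ 4 * ∑ j, pderiv j W x ^ 2) + 96 * c ^ 2 * ∫ x, φ x ^ 2 * W x ^ 2) +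
        (∫ x, 4 * φ x ^ 3 * (∑ j, pderiv j φ x * v x j) * W x ^ 2) +
        2 * ∫ x, φ x ^ 4 * (W x * (Wdot x - ν * ∑ j, pderiv j (pderiv j W) x +
          ∑ j, v x j * pderiv j W x)) := by
  have hφcont := hφ.continuous
  have cW := hW.continuous
  have cdW : ∀ j, Continuous (pderiv j W) := fun j => continuous_pderiv hW (by simp) j
  have cddW : ∀ j, Continuous (pderiv j (pderiv j W)) := fun j =>
    continuous_pderiv (contDiff_pderiv hW j) (by simp) j
  have cV : ∀ j, Continuous fun y => v y j := fun j => (contDiff_comp_of_contDiff hv j).continuous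
  have cL : Continuous fun x => ∑ j, pderiv j (pderiv j W) x := continuous_finsetSum _ fun j _ => cddW j
  have cT : Continuous fun x => ∑ j, v x j * pderiv j W x :=
    continuous_finsetSum _ fun j _ => (cV j).mul (cdW j)
  have i1 : Integrable fun x => φ x ^ 4 * (W x * ∑ j, pderiv j (pderiv j W) x) :=
    integrable_pow_mul_of_continuous hφcont hφc (cW.mul cL) (by norm_num)
  have i2 : Integrable fun x => φ x ^ 4 * (W x * ∑ j, v x j * pderiv j W x) :=
    integrable_pow_mul_of_continuous hφcont hφc (cW.mul cT) (by norm_num)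
  have i3 : Integrable fun x => φ x ^ 4 * (W x * (Wdot x - ν * ∑ j, pderiv j (pderiv j W) x +
      ∑ j, v x j * pderiv j W x)) :=
    integrable_pow_mul_of_continuous hφcont hφc
      (cW.mul ((hWdot.sub (continuous_const.mul cL)).add cT)) (by norm_num)
  have hsplit : ∫ x, φ x ^ 4 * (Wdot x * W x) =
      ν * (∫ x, φ x ^ 4 * (W x * ∑ j, pderiv j (pderiv j W) x)) -
        (∫ x, φ x ^ 4 * (W x * ∑ j, v x j * pderiv j W x)) +
        ∫ x, φ x ^ 4 * (W x * (Wdot x - ν * ∑ j, pderiv j (pderiv j W) x +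
          ∑ j, v x j * pderiv j W x)) := by
    have e : (fun x => φ x ^ 4 * (Wdot x * W x)) =
        fun x => (ν * (φ x ^ 4 * (W x * ∑ j, pderiv j (pderiv j W) x)) -
          φ x ^ 4 * (W x * ∑ j, v x j * pderiv j W x)) +
          φ x ^ 4 * (W x * (Wdot x - ν * ∑ j, pderiv j (pderiv j W) x +
            ∑ j, v x j * pderiv j W x)) := by
      funext x; ring
    have i12 : Integrable fun x => ν * (φ x ^ 4 * (W x * ∑ j, pderiv j (pderiv j W) x)) -
        φ x ^ 4 * (W x * ∑ j, v x j * pderiv j W x) := (i1.const_mul ν).sub i2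
    rw [e, integral_add i12 i3, integral_sub (i1.const_mul ν) i2, integral_const_mul]
  have hvisc := viscous_pairing_le hW hφ hφc hφ0 hc
  simp only [Fintype.card_fin] at hvisc
  push_cast at hvisc
  have htrans := transport_pairing_eq hW hv hdiv hφ hφc
  rw [hsplit]
  nlinarith [hvisc, htrans]

/-- **The slice energy inequality (core).** Given `ν > 0`, the cutoff gradient bound `c ≥ 0`, the
forcing constant `C_F ≥ 0`, `n ≥ 1` and global bounds `S m` (`m ≤ n`), there is `C₀` with the
following property. Let `v` be smooth and divergence free with `∫ |∇ᵐv|² ≤ S m` for `m ≤ n`,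
`0 ≤ φ ≤ 1` smooth compactly supported with `‖Dφ‖ ≤ c`, `φ'` a companion cutoff (`= 1` where
`φ ≠ 0`), and `Ẇ_{βki}` continuous functions satisfying the differentiated vorticity equation
`|Ẇ_{βki} − νΔ∂^βΩ_{ki} + v·∇∂^βΩ_{ki}| ≤ C_F ∑_{a=1}^{n+1} |∇ᵃv| |∇^{n+2-a}v|` pointwise. Then
`∑ 2 ∫ φ⁴ Ẇ_{βki} ∂^βΩ_{ki} ≤ −ν ∫ φ⁴ |∇^{n+1}Ω|² + C₀ (1 + ∫ φ⁴ |∇ⁿΩ|² + ∫ φ² |∇^{n+1}v|²)`.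
[folklore] -/
theorem slice_energy_inequality_core {ν c CF : ℝ} (hν : 0 < ν) (hc : 0 ≤ c) (hCF : 0 ≤ CF)
    {n : ℕ} (hn : 1 ≤ n) (S : ℕ → ℝ) (hS : ∀ m, 0 ≤ S m) :
    ∃ C₀ : ℝ, 0 ≤ C₀ ∧ ∀ (v : EuclideanSpace ℝ (Fin 3) → EuclideanSpace ℝ (Fin 3)) (φ φ' : EuclideanSpace ℝ (Fin 3) → ℝ)
      (Wdot : (Fin n → Fin 3) × Fin 3 × Fin 3 → EuclideanSpace ℝ (Fin 3) → ℝ),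
      ContDiff ℝ ∞ v → (∀ x, ∑ i, pderiv i (fun y => v y i) x = 0) →
      ContDiff ℝ ∞ φ → HasCompactSupport φ → (∀ x, 0 ≤ φ x) → (∀ x, φ x ≤ 1) →
      (∀ x, ‖fderiv ℝ φ x‖ ≤ c) →
      ContDiff ℝ ∞ φ' → HasCompactSupport φ' → (∀ x, 0 ≤ φ' x) → (∀ x, φ' x ≤ 1) →
      (∀ x, ‖fderiv ℝ φ' x‖ ≤ c) → (∀ x, φ x ≠ 0 → φ' x = 1) →
      (∀ c', Continuous (Wdot c')) →
      (∀ c' x, |Wdot c' x - ν * ∑ j, pderiv j (pderiv j (vortFam n v c')) x +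
          ∑ j, v x j * pderiv j (vortFam n v c') x| ≤
        CF * ∑ a ∈ Finset.Icc 1 (n + 1),
          Real.sqrt (levelSq a v x) * Real.sqrt (levelSq (n + 2 - a) v x)) →
      (∀ m ≤ n, Integrable (levelSq m v)) → (∀ m ≤ n, ∫ x, levelSq m v x ≤ S m) →
      ∑ c', 2 * ∫ x, φ x ^ 4 * (Wdot c' x * vortFam n v c' x) ≤
        -ν * (∫ x, φ x ^ 4 * vortSq (n + 1) v x) +
          C₀ * (1 + (∫ x, φ x ^ 4 * vortSq n v x) + ∫ x, φ x ^ 2 * levelSq (n + 1) v x) := by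
  obtain ⟨CT, hCT0, hCT⟩ := transport_term_le hν hc (hS 0) (hS 1) n
  obtain ⟨CF', hCF'0, hCF'⟩ := forcing_term_le (c := c) hν hCF hn S hS
  refine ⟨384 * ν * c ^ 2 + CT + CF', by positivity, fun v φ φ' Wdot hv hdiv hφ hφc hφ0 hφ1 hcφ hφ'
    hφ'c hφ'0 hφ'1 hcφ' hφφ' hWc hforce hint hSv => ?_⟩
  have hpφ : ∀ l x, |pderiv l φ x| ≤ c := fun l x => (abs_pderiv_le_norm_fderiv l φ x).trans (hcφ x)
  have hφcont := hφ.continuous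
  have hX0 : 0 ≤ ∫ x, φ x ^ 4 * vortSq n v x :=
    integral_nonneg fun x => mul_nonneg (pow_nonneg (hφ0 x) 4) (vortSq_nonneg _ _ _)
  have hY0 : 0 ≤ ∫ x, φ x ^ 2 * levelSq (n + 1) v x :=
    integral_nonneg fun x => mul_nonneg (sq_nonneg _) (levelSq_nonneg _ _ _)
  -- levels `0` and `1`
  have hn0 : 0 ≤ n := Nat.zero_le _
  have hv0 : Integrable fun x => ‖v x‖ ^ 2 :=
    (hint 0 hn0).congr (Eventually.of_forall fun x => levelSq_zero_eq_norm_sq v x)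
  have hS₀v : ∫ x, ‖v x‖ ^ 2 ≤ S 0 := by
    refine le_trans (le_of_eq ?_) (hSv 0 hn0)
    exact integral_congr_ae (Eventually.of_forall fun x => (levelSq_zero_eq_norm_sq v x).symm)
  -- the per-component inequality, summed
  have hWsm : ∀ c', ContDiff ℝ ∞ (vortFam n v c') := fun c' => contDiff_vortFam hv n c'
  have hcomp := fun c' => component_pairing_le (hWsm c') (hWc c') hv hdiv hφ hφc hφ0 hpφ hν.le
    (Wdot := Wdot c')
  have hsum := Finset.sum_le_sum fun c' (_ : c' ∈ Finset.univ) => hcomp c'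
  -- (1) the dissipation: `∑_c ∫ φ⁴ |∇W_c|² = ∫ φ⁴ |∇^{n+1}Ω|²`
  have cdW : ∀ c' j, Continuous (pderiv j (vortFam n v c')) := fun c' j =>
    continuous_pderiv (hWsm c') (by simp) j
  have iA : ∀ c', Integrable fun x => φ x ^ 4 * ∑ j, pderiv j (vortFam n v c') x ^ 2 := fun c' =>
    integrable_pow_mul_of_continuous hφcont hφc
      (continuous_finsetSum _ fun j _ => (cdW c' j).pow 2) (by norm_num)
  have iB : ∀ c', Integrable fun x => φ x ^ 2 * vortFam n v c' x ^ 2 := fun c' =>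
    integrable_pow_mul_of_continuous hφcont hφc ((hWsm c').continuous.pow 2) (by norm_num)
  have e1 : ∑ c', ∫ x, φ x ^ 4 * ∑ j, pderiv j (vortFam n v c') x ^ 2 =
      ∫ x, φ x ^ 4 * vortSq (n + 1) v x := by
    rw [← integral_finsetSum _ fun c' _ => iA c']
    refine integral_congr_ae (Eventually.of_forall fun x => ?_)
    simp only
    rw [← Finset.mul_sum, ← sum_sq_pderiv_vortFam n v x, Finset.sum_comm]
  -- (2) `∑_c ∫ φ² W_c² = ∫ φ² |∇ⁿΩ|² ≤ 4 Y`
  have e2 : ∑ c', ∫ x, φ x ^ 2 * vortFam n v c' x ^ 2 = ∫ x, φ x ^ 2 * vortSq n v x := by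
    rw [← integral_finsetSum _ fun c' _ => iB c']
    refine integral_congr_ae (Eventually.of_forall fun x => ?_)
    simp only
    rw [← Finset.mul_sum, sum_sq_vortFam]
  have h2 := integral_sq_mul_vortSq_le hv hφ hφc n
  -- (3) the transport terms
  have cdφ : ∀ j, Continuous (pderiv j φ) := fun j => continuous_pderiv hφ (by simp) j
  have cV : ∀ j, Continuous fun y => v y j := fun j => (contDiff_comp_of_contDiff hv j).continuous
  have e3 : ∑ c', ∫ x, 4 * φ x ^ 3 * (∑ j, pderiv j φ x * v x j) * vortFam n v c' x ^ 2 =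
      ∫ x, 4 * φ x ^ 3 * (∑ j, pderiv j φ x * v x j) * vortSq n v x := by
    have hi : ∀ c', Integrable fun x => 4 * φ x ^ 3 * (∑ j, pderiv j φ x * v x j) *
        vortFam n v c' x ^ 2 := by
      intro c'
      have : (fun x => 4 * φ x ^ 3 * (∑ j, pderiv j φ x * v x j) * vortFam n v c' x ^ 2) =
          fun x => φ x ^ 3 * (4 * (∑ j, pderiv j φ x * v x j) * vortFam n v c' x ^ 2) := by
        funext x; ring
      rw [this]
      exact integrable_pow_mul_of_continuous hφcont hφc ((continuous_const.mul
        (continuous_finsetSum _ fun j _ => (cdφ j).mul (cV j))).mul ((hWsm c').continuous.pow 2))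
        (by norm_num)
    rw [← integral_finsetSum _ fun c' _ => hi c']
    refine integral_congr_ae (Eventually.of_forall fun x => ?_)
    simp only
    rw [← Finset.mul_sum, sum_sq_vortFam]
  have h3 := hCT v φ φ' hv hφ hφc hφ0 hφ1 hcφ hφ' hφ'c hφ'0 hφ'1 hcφ' hφφ' hv0 hS₀v (hint 1 hn)
    (hSv 1 hn)
  -- (4) the forcing terms
  have hF := hCF' v φ (fun c' x => Wdot c' x - ν * ∑ j, pderiv j (pderiv j (vortFam n v c')) x +
      ∑ j, v x j * pderiv j (vortFam n v c') x) hv hdiv hφ hφc hφ0 hφ1 hcφ (fun c' => ?_) hforce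
    hint hSv
  swap
  · exact ((hWc c').sub (continuous_const.mul (continuous_finsetSum _ fun j _ =>
      continuous_pderiv (contDiff_pderiv (hWsm c') j) (by simp) j))).add
      (continuous_finsetSum _ fun j _ => (cV j).mul (cdW c' j))
  -- assemble
  simp only [Finset.sum_add_distrib, ← Finset.mul_sum, e1, e2, e3] at hsum
  rw [← Finset.mul_sum] at hF ⊢
  have hc2 : 0 ≤ c ^ 2 := sq_nonneg c
  nlinarith [hsum, h2, h3, hF, mul_nonneg hν.le hc2, mul_nonneg (mul_nonneg hν.le hc2) hY0,
    mul_nonneg hCT0 hX0, hCF'0]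

end SliceCore

end Literature.Analysis.FluidPDE

end
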